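import Mathlib
import Literature.Computability.Complexity.SosHypercontractivity
import HarnessLib

/-!
# Sum-of-squares proof of the `(2,2s)`-hypercontractive inequality for all even `q = 2s`
# (Kauers–O'Donnell–Tan–Zhou 2014, §3)

Source (read first-hand 2026-08-28: arXiv PDF, 21 pp.; the held corpus text `paper:arxiv-1212.5324` is a
TeX-source materialisation whose chunk numbers are not PDF pages): M. Kauers, R. O'Donnell, L.-Y. Tan,
Y. Zhou, *Hypercontractive inequalities via SOS, and the Frankl–Rödl graph*, SODA 2014;
arXiv:1212.5324v3 (1 Mar 2016) [KauersODonnellTanZhou2012].  Locators below are theorem numbers and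
pages of that PDF: Thm 1.1/1.2 (p. 2), Thm 1.4 (informal) and its corollaries (p. 4), §3 "The
hypercontractive inequality in SOS": `s`-Moment Conditions and Remark 3.1 (p. 8), Thm 3.2, Lemma 3.3,
Thm 3.4 = eq. (3) (p. 9), proof of Thm 3.4 with eqs. (4)–(6) (p. 10).

This file completes the tree's copy of KOTZ §3.  The sibling file `SosHypercontractivity.lean`
(BBHKSZ 2012 Lemma 5.1 / Thm 2.2 and KOTZ Thm 3.4 for `s = 2`) supplies the vocabulary, reused verbatim:
`IsSosDeg k p` ("`⊢_{2k} p ≥ 0`": `p` is a sum of squares of polynomials of total degree `≤ k`),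
`fourierPoly a x = Σ_S χ_S(x)·a S` (a Fourier polynomial on `{0,1}ⁿ` with coefficient polynomials
`a S = f̂(S) ∈ MvPolynomial σ ℝ` of degree `≤ 1` — indeterminates, linear forms or `0`, as in both
sources), `sqNorm a = Σ_S (a S)²` (`= E f²`), `noise ρ a` (`T_ρ`), `proj d a` (`P_{≤d}`), `lo a`/`hi a`
(`f = f₀ + x₀ f₁`, `fourierPoly_cons`).  Uniform `±1` bits = Walsh characters `χ_S` on the cube
`{0,1}ⁿ` with the uniform (counting) measure, `E_x = 2⁻ⁿ Σ_x`.

## What is typed and proved (everything; no named facts)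

* **Theorem 3.4** (p. 9, eq. (3)) for uniform `±1` bits — "Fix `s ∈ ℕ⁺` and write `q = 2s`. Let
  `0 ≤ ρ ≤ 1/√(q−1)`. … introduce an indeterminate `f̂_i(S)` … Then
  `⊢_q E[∏_{i=1}^s (T_ρ f_i(x))²] ≤ ∏_{i=1}^s E[f_i(x)²]`":
  `multi_function_sos_hypercontractivity` (the difference `∏_i Σ_S f̂_i(S)² − 2⁻ⁿ Σ_x ∏_i (T_ρ f_i)(x)²`
  is a sum of squares of polynomials of degree `≤ s` in the coefficients), and its cleared-denominator /
  weighted form at `ρ² = 1/(2s−1)`, `multi_function_sos_hypercontractivity_weighted`: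
  `⊢_{2s} Σ_x ∏_i f_i(x)² ≤ 2ⁿ ∏_i ‖T_{√(2s−1)} f_i‖₂²` (`‖T_{√w} f‖₂² = Σ_S w^{|S|} f̂(S)² = sqNormW w`),
  which is the statement the induction on `n` actually carries (for `s = 2` it is the sibling file's
  `two_function_sos_hypercontractivity_noise` with `sqNorm3`).
* **Lemma 3.3** (p. 9), the SOS AM–GM inequality over half-subsets: `sos_amgm_halfSubsets` (as printed,
  `⊢_{2v} ∏_{i∈V} G_iH_i ≤ C(v,v/2)⁻¹ Σ_{|T|=v/2} ∏_T G_i² ∏_{V∖T} H_i²`, certificate explicit) and the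
  identity form used in the proof, `amgm_identity`
  (`2C(2t,t)∏_V G_iH_i = 2Σ_T P_T² − Σ_T (P_T − P_{V∖T})²`).
* the corollaries stated after Theorem 1.4 (p. 4: "As corollaries we have SOS proofs of
  `‖T_ρ f‖_q^q ≤ ‖f‖₂^q` and `‖P_{≤k} f‖_q^q ≤ (q−1)^{qk/2}‖f‖₂^q`"):
  `sos_hypercontractivity_even_noise_self` and `sos_hypercontractivity_even_projector`
  (`(2s−1)^{ks}(Σ_S X_S²)^s − 2⁻ⁿΣ_x (P_k f)(x)^{2s}` is a sum of squares of degree-`s` polynomials in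
  the `2ⁿ` indeterminate coefficients `X_S`; for `s = 2` this is BBHKSZ Thm 2.2 / the sibling file's
  `sos_hypercontractivity_projector` with `9^k`);
* what a degree-`2s` pseudo-expectation sees (`pseudoexpectation_evenMoment_le`:
  `Ẽ[E_x(P_k f)^{2s}] ≤ (2s−1)^{ks} Ẽ[(Σ f̂²)^s]` for every linear `Ẽ` nonnegative on squares of
  degree-`≤ s` polynomials), and the numerical `(2,2s)` inequality of Theorem 1.2 (p. 2,
  "`‖P_{≤k} f‖_q ≤ (q−1)^{k/2}‖f‖₂`", `q = 2s`, uniform bits) read off the certificate by evaluation,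
  `evenMoment_hypercontractivity_of_certificate` (the tree's `LowDegree.bonami_even_moment` is the same
  inequality proved directly).

## The proof (the printed induction, followed step by step)

KOTZ prove (3) by induction on `n`, splitting `f_i = h_i + x_n g_i` (here: the FIRST coordinate,
`lo`/`hi`), expanding `E_{x_n} ∏_i (ρ²x_n²G̃_i² + 2ρx_nG̃_iH̃_i + H̃_i²)` over the partitions `(U,V,W)` of
`[s]` (eq. (4); odd `|V|` die), applying Lemma 3.3 to each `∏_{i∈V} G̃_iH̃_i` "multiplied against an SOS
polynomial", using the moment bound and the induction hypothesis termwise (eq. (5)), and finally checking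
that after regrouping by `R = U ∪ T` every coefficient is right, which is the binomial identity (6),
`Σ_{v'} 4^{v'}/C(2v',v')·C(r,v')C(s−r,v') = C(2s,2r)/C(s,r)`, "proved computationally using Zeilberger's
algorithm".  Sections of this file:

* §1 `Arithmetic` — eq. (6) WITHOUT computer algebra: `C(s,r)·κ_s(r) = C(2s,2r)` (`choose_mul_kap`) from
  the generating function `((1+X²)+2X)^s = (1+X)^{2s}` (`sum_four_pow_mul_choose`, in `Polynomial ℕ` via
  `Polynomial.expand`) and the multinomial renormalisation `choose_triple`; the Rademacher moment bound in
  the form `C(2s,2r) ≤ (2s−1)^r C(s,r)` (= the termwise step of Thm 3.2 / Remark 3.1; this is the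
  tree's `LowDegree.choose_two_mul_le` of `BonamiLevelK.lean`, O'Donnell §9.1, reused, not restated);
  hence `κ_s(r) ≤ (2s−1)^r` (`kap_le`).  [Deviation from print: generating function instead of
  Zeilberger; same identity.]
* §2 `OneVariable` — the induction step isolated as an exact identity with polynomial coefficients
  `G_i, H_i` (`one_variable`): `∏_i(H_i+G_i)² + ∏_i(H_i−G_i)² + rem = Σ_{A⊆[s]} 2κ_s(|A|)·M_A²`,
  `M_A = ∏_{i∈A}G_i ∏_{i∉A}H_i`, where `rem` is the EXPLICIT sum of the squares
  `(4^t/C(2t,t))·(∏_W H ∏_U G (P_T − P_{V∖T}))²` discarded by Lemma 3.3 (`twoPoint_expand` = eq. (4) summed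
  over the sign of the bit; `core_step` = Lemma 3.3 inside one term; `reindex_main` = the regrouping by
  `R = U ∪ T`, done by elementary reindexing of sums over subsets).  `isSosDeg_rem`: the squares have
  degree `≤ s` when the `G_i, H_i` are linear.
* §3 `Induction` — `weighted_induction`: for a family indexed by a finite type `ι` and any weight `w ≥ 0`
  with `2κ_{|ι|}(r) ≤ 2w^r`, `2ⁿ∏_i‖T_{√w}f_i‖₂² − Σ_x∏_i f_i(x)²` is `IsSosDeg |ι|`; the step applies
  `one_variable` pointwise in the remaining variables, the induction hypothesis to each mixed family
  `(g_i)_{i∈A} ∪ (h_i)_{i∉A}` (`mix`), and the slack `2ⁿ(2w^{|A|} − 2κ(|A|))·∏_i‖·‖²` is itself a sum of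
  squares (`isSosDeg_prod`).  [Deviation from print: KOTZ carry `T_ρ` on the left; we carry the
  equivalent weight `w = ρ⁻²` on the right, as the sibling file does for `s = 2`, and recover the printed
  `T_ρ` form for all `0 ≤ ρ ≤ 1/√(2s−1)` afterwards by comparing weights (`isSosDeg_prod_weighted_sub`).]
* §4 the printed statements listed above.

Scope notes (recorded, not silent): (i) KOTZ state Thm 3.2/3.4 for arbitrary independent real random
variables under the `s`-Moment Conditions `E[x^{2j−1}] = 0`, `E[x^{2j}] ≤ (2s−1)^j C(s,j)/C(2s,2j)`; typed
here is the case of uniform `±1` bits (the cube of the tree's Fourier-analysis files), which satisfy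
them by Remark 3.1 — `-- TODO(general form)`: product measures with the `s`-Moment Conditions; (ii) as in
the sibling file, "`⊢_{2s}`" is rendered by exhibiting the certificate (`IsSosDeg s`), which is what a
degree-`2s` pseudo-expectation consumes (`IsSosDeg.pseudoexpectation_nonneg`).  Everything is proved;
no named facts, no new notation.  Printed open questions (§6 "Conclusions", p. 18) are recorded in the
sibling file's docstring.
-/

noncomputable section

open Finset

namespace Literature.Computability.Complexity.SosHypercontractivityEvenMoments

/-! ### §1 Arithmetic: the binomial identity behind the induction (replaces the printed Zeilberger step) -/

section Arithmetic

open Polynomial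


/-! #### A1: `Σ_t 4^t C(s,2t) C(s-2t,r-t) = C(2s,2r)` by the generating function `((1+X²)+2X)^s = (1+X)^{2s}` -/

/-- The coefficients of `(1+X²)^m`: `C(m, n/2)` at even `n`, `0` at odd `n`. [folklore] -/
private theorem coeff_one_add_X_sq_pow (m n : ℕ) :
    ((1 + (Polynomial.X : Polynomial ℕ) ^ 2) ^ m).coeff n = if 2 ∣ n then m.choose (n / 2) else 0 := by
  have h : (1 + (Polynomial.X : Polynomial ℕ) ^ 2) ^ m = Polynomial.expand ℕ 2 ((1 + Polynomial.X) ^ m) := by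
    rw [map_pow, map_add, map_one, Polynomial.expand_X]
  rw [h, Polynomial.coeff_expand two_pos, Polynomial.coeff_one_add_X_pow, Nat.cast_id]

/-- `C(2s,2r) = Σ_{c ≤ s, c even, c ≤ 2r} 2^c C(s,c) C(s−c,(2r−c)/2)`: compare the coefficients of
`X^{2r}` in `(1+X)^{2s} = ((1+X²) + 2X)^s`.  This and the next identity replace the printed appeal to
Zeilberger's algorithm for eq. (6). [cite: KauersODonnellTanZhou2012, proof of Thm. 3.4, eq. (6) (p. 10)] -/
theorem choose_two_mul_eq_sum (s r : ℕ) :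
    (2 * s).choose (2 * r) = ∑ c ∈ range (s + 1),
      if 2 ∣ c ∧ c ≤ 2 * r then 2 ^ c * s.choose c * (s - c).choose ((2 * r - c) / 2) else 0 := by
  have key : ((1 + Polynomial.X : Polynomial ℕ) ^ (2 * s)) = (Polynomial.C 2 * Polynomial.X + (1 + Polynomial.X ^ 2)) ^ s := by
    rw [pow_mul]
    congr 1
    rw [show (Polynomial.C 2 : Polynomial ℕ) = 2 from map_ofNat Polynomial.C 2]
    ring
  have h1 : ((1 + Polynomial.X : Polynomial ℕ) ^ (2 * s)).coeff (2 * r) = (2 * s).choose (2 * r) := by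
    rw [Polynomial.coeff_one_add_X_pow, Nat.cast_id]
  rw [← h1, key, add_pow, Polynomial.finsetSum_coeff]
  refine sum_congr rfl fun c _ => ?_
  have e : (Polynomial.C 2 * Polynomial.X : Polynomial ℕ) ^ c * (1 + Polynomial.X ^ 2) ^ (s - c) * (s.choose c : Polynomial ℕ) =
      Polynomial.C (2 ^ c * s.choose c) * (Polynomial.X ^ c * (1 + Polynomial.X ^ 2) ^ (s - c)) := by
    rw [← map_natCast Polynomial.C (s.choose c), map_mul, map_pow, Nat.cast_id]
    ring
  rw [e, Polynomial.coeff_C_mul, Polynomial.coeff_X_pow_mul', coeff_one_add_X_sq_pow]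
  by_cases hc : c ≤ 2 * r
  · by_cases h2 : 2 ∣ c
    · have h2' : 2 ∣ 2 * r - c := (Nat.dvd_sub_iff_right hc (dvd_mul_right 2 r)).2 h2
      simp [hc, h2, h2', mul_assoc]
    · have h2' : ¬ 2 ∣ 2 * r - c := fun h => h2 ((Nat.dvd_sub_iff_right hc (dvd_mul_right 2 r)).1 h)
      simp [hc, h2, h2']
  · simp [hc]

/-- **The binomial identity behind eq. (6):** `Σ_{t ≤ r} 4^t C(s,2t) C(s−2t,r−t) = C(2s,2r)`
(count the `2r`-subsets of `s` disjoint pairs by the number `2t` of split pairs).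
[cite: KauersODonnellTanZhou2012, proof of Thm. 3.4, eq. (6) (p. 10)] -/
theorem sum_four_pow_mul_choose (s r : ℕ) :
    ∑ t ∈ range (r + 1), 4 ^ t * s.choose (2 * t) * (s - 2 * t).choose (r - t) =
      (2 * s).choose (2 * r) := by
  rw [choose_two_mul_eq_sum]
  set F : ℕ → ℕ := fun c =>
    if 2 ∣ c ∧ c ≤ 2 * r then 2 ^ c * s.choose c * (s - c).choose ((2 * r - c) / 2) else 0 with hF
  have hFt : ∀ t, F (2 * t) = if t ≤ r then 4 ^ t * s.choose (2 * t) * (s - 2 * t).choose (r - t) else 0 := by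
    intro t
    simp only [hF]
    by_cases ht : t ≤ r
    · have h : 2 ∣ 2 * t ∧ 2 * t ≤ 2 * r := ⟨dvd_mul_right 2 t, by omega⟩
      rw [if_pos h, if_pos ht, pow_mul, show (2 : ℕ) ^ 2 = 4 by norm_num,
        show (2 * r - 2 * t) / 2 = r - t by omega]
    · have h : ¬ (2 ∣ 2 * t ∧ 2 * t ≤ 2 * r) := fun h => ht (by omega)
      rw [if_neg h, if_neg ht]
  -- both sides equal the sum of `F` over the even numbers `2t`, `t ≤ r`
  have himage : ∑ t ∈ range (r + 1), 4 ^ t * s.choose (2 * t) * (s - 2 * t).choose (r - t) =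
      ∑ c ∈ (range (r + 1)).image (fun t => 2 * t), F c := by
    rw [sum_image fun a _ b _ (h : 2 * a = 2 * b) => by omega]
    refine sum_congr rfl fun t ht => ?_
    rw [hFt, if_pos (Nat.lt_succ_iff.1 (mem_range.1 ht))]
  rw [himage]
  -- compare both with the sum over the union
  have hA : ∑ c ∈ (range (r + 1)).image (fun t => 2 * t), F c =
      ∑ c ∈ (range (r + 1)).image (fun t => 2 * t) ∪ range (s + 1), F c := by
    refine sum_subset subset_union_left fun c hc hc' => ?_
    simp only [hF]
    rw [if_neg]
    rintro ⟨⟨t, rfl⟩, h2⟩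
    exact hc' (mem_image.2 ⟨t, mem_range.2 (by omega), rfl⟩)
  have hB : ∑ c ∈ range (s + 1), F c =
      ∑ c ∈ (range (r + 1)).image (fun t => 2 * t) ∪ range (s + 1), F c := by
    refine sum_subset subset_union_right fun c hc hc' => ?_
    have hcs : s < c := by simpa [mem_range, Nat.lt_succ_iff] using hc'
    simp only [hF]
    split_ifs
    · rw [Nat.choose_eq_zero_of_lt hcs]; simp
    · rfl
  rw [hA, hB]

/-! #### A2: `C(s,r) C(r,t) C(s-r,t) = C(2t,t) C(s,2t) C(s-2t,r-t)` -/

/-- `C(m,a) C(m−a,b) = C(m,b) C(m−b,a)` (both are the trinomial coefficient). [folklore] -/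
private theorem choose_mul_choose_sub_comm (m a b : ℕ) :
    m.choose a * (m - a).choose b = m.choose b * (m - b).choose a := by
  have h1 : m.choose (a + b) * (a + b).choose a = m.choose a * (m - a).choose b := by
    rw [Nat.choose_mul (Nat.le_add_right a b), Nat.add_sub_cancel_left]
  have h2 : m.choose (a + b) * (a + b).choose b = m.choose b * (m - b).choose a := by
    rw [Nat.choose_mul (Nat.le_add_left b a), Nat.add_sub_cancel]
  rw [← h1, ← h2, Nat.choose_symm_add]

/-- `C(s,r) C(r,t) C(s−r,t) = C(2t,t) C(s,2t) C(s−2t,r−t)` (both are `s!/(t! t! (r−t)! (s−r−t)!)`), the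
renormalisation turning the coefficient sum of eq. (6) into `sum_four_pow_mul_choose`.
[cite: KauersODonnellTanZhou2012, proof of Thm. 3.4, eq. (6) (p. 10)] -/
theorem choose_triple (s r t : ℕ) (ht : t ≤ r) :
    s.choose r * (r.choose t * (s - r).choose t) =
      (2 * t).choose t * (s.choose (2 * t) * (s - 2 * t).choose (r - t)) := by
  have h1 : s.choose r * r.choose t = s.choose t * (s - t).choose (r - t) := Nat.choose_mul ht
  have h2 : s.choose (2 * t) * (2 * t).choose t = s.choose t * (s - t).choose t := by
    rw [Nat.choose_mul (by omega : t ≤ 2 * t), show 2 * t - t = t by omega]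
  have h3 : (s - t).choose (r - t) * (s - r).choose t = (s - t).choose t * (s - 2 * t).choose (r - t) := by
    have := choose_mul_choose_sub_comm (s - t) (r - t) t
    rwa [show s - t - (r - t) = s - r by omega, show s - t - t = s - 2 * t by omega] at this
  calc s.choose r * (r.choose t * (s - r).choose t)
      = (s.choose r * r.choose t) * (s - r).choose t := by ring
    _ = s.choose t * ((s - t).choose (r - t) * (s - r).choose t) := by rw [h1, mul_assoc]
    _ = s.choose t * ((s - t).choose t * (s - 2 * t).choose (r - t)) := by rw [h3]
    _ = (s.choose (2 * t) * (2 * t).choose t) * (s - 2 * t).choose (r - t) := by rw [h2, mul_assoc]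
    _ = (2 * t).choose t * (s.choose (2 * t) * (s - 2 * t).choose (r - t)) := by ring

/-! #### A3: the coefficient `κ(r) = Σ_t 4^t/C(2t,t) C(r,t) C(s-r,t) ≤ (2s-1)^r` -/

/-- **The coefficient `κ_s(r) = Σ_t (4^t/C(2t,t)) C(r,t) C(s−r,t)`** multiplying
`∏_{i∈R} E[G_i²] ∏_{i∉R} E[H_i²]` (`|R| = r`) after the AM–GM step of the proof of Theorem 3.4 (the
printed normalised sum of eq. (6) is `κ_s(r)·C(s,r)/C(2s,2r) = 1`). [cite: KauersODonnellTanZhou2012, proof of Thm. 3.4, eq. (5)–(6) (p. 10)] -/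
noncomputable def kap (s r : ℕ) : ℝ :=
  ∑ t ∈ range (r + 1), (4 : ℝ) ^ t / (2 * t).choose t * r.choose t * (s - r).choose t

/-- **Eq. (6):** `C(s,r)·κ_s(r) = C(2s,2r)`, i.e. `Σ_{v'} 4^{v'}/C(2v',v')·C(r,v')C(s−r,v') = C(2s,2r)/C(s,r)`
("This identity can be proved computationally using Zeilberger's algorithm"; here: `choose_triple` and
`sum_four_pow_mul_choose`). [cite: KauersODonnellTanZhou2012, proof of Thm. 3.4, eq. (6) (p. 10)] -/
theorem choose_mul_kap (s r : ℕ) :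
    (s.choose r : ℝ) * kap s r = (2 * s).choose (2 * r) := by
  rw [kap, mul_sum, ← sum_four_pow_mul_choose, Nat.cast_sum]
  refine sum_congr rfl fun t ht => ?_
  have ht' : t ≤ r := Nat.lt_succ_iff.1 (mem_range.1 ht)
  have hc : ((2 * t).choose t : ℝ) ≠ 0 := by exact_mod_cast (Nat.choose_pos (by omega)).ne'
  have key := choose_triple s r t ht'
  have key' : (s.choose r : ℝ) * (r.choose t * (s - r).choose t) =
      (2 * t).choose t * (s.choose (2 * t) * (s - 2 * t).choose (r - t)) := by exact_mod_cast key
  push_cast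
  calc (s.choose r : ℝ) * ((4 : ℝ) ^ t / (2 * t).choose t * r.choose t * (s - r).choose t)
      = (4 : ℝ) ^ t / (2 * t).choose t * ((s.choose r : ℝ) * (r.choose t * (s - r).choose t)) := by ring
    _ = (4 : ℝ) ^ t / (2 * t).choose t * ((2 * t).choose t * (s.choose (2 * t) * (s - 2 * t).choose (r - t))) := by
        rw [key']
    _ = (4 : ℝ) ^ t * s.choose (2 * t) * (s - 2 * t).choose (r - t) := by
        field_simp

/-- **`κ_s(r) ≤ (2s−1)^r`** for `r ≤ s` — eq. (6) combined with the Rademacher moment bound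
`C(2s,2r) ≤ (2s−1)^r C(s,r)` (Remark 3.1 / proof of Thm 3.2 for uniform bits; in the tree as
`LowDegree.choose_two_mul_le`, O'Donnell §9.1); this is the coefficient comparison that closes the
induction.
[cite: KauersODonnellTanZhou2012, proof of Thm. 3.4 (p. 10) with Remark 3.1 (p. 8)] -/
theorem kap_le (s r : ℕ) (hr : r ≤ s) : kap s r ≤ (2 * s - 1 : ℝ) ^ r := by
  have hpos : (0 : ℝ) < s.choose r := by exact_mod_cast Nat.choose_pos hr
  -- `C(2s,2r) ≤ (2s−1)^r C(s,r)`: the tree's Bonami two-point estimate (O'Donnell §9.1), which is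
  -- KOTZ's Remark 3.1 / proof of Thm 3.2 for uniform bits
  have h' : ((2 * s).choose (2 * r) : ℝ) ≤ (2 * s - 1 : ℝ) ^ r * s.choose r :=
    Literature.Computability.Complexity.LowDegree.choose_two_mul_le s r hr
  rw [← choose_mul_kap s r] at h'
  nlinarith

/-- `κ_s(r) ≥ 0`. [folklore] -/
private theorem kap_nonneg (s r : ℕ) : 0 ≤ kap s r :=
  sum_nonneg fun t _ => by positivity


end Arithmetic

open MvPolynomial
open Literature.Computability.Complexity.SosHypercontractivity
open Literature.Probability.RandomGraphs.LowDegree (sgn walsh sgn_true sgn_false walsh_empty)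
open Literature.Computability.Complexity.LowDegree (card_insert_zero_map_succEmb)

/-! ### §2 Lemma 3.3 and the one-variable decomposition (KOTZ p. 8–9) -/

section OneVariable

variable {σ : Type*} {ι : Type*} [DecidableEq ι]



/-! #### B2: Lemma 3.3 (SOS AM–GM over half-subsets), identity form -/

/-- `P_T = ∏_{i∈T} G_i · ∏_{i∈V∖T} H_i`, the half-products of Lemma 3.3. [cite: KauersODonnellTanZhou2012, proof of Lemma 3.3 (p. 9)] -/
def halfProd (G H : ι → MvPolynomial σ ℝ) (V T : Finset ι) : MvPolynomial σ ℝ := (∏ i ∈ T, G i) * ∏ i ∈ V \ T, H i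

/-- `P_T · P_{V∖T} = ∏_{i∈V} G_i H_i` ("we first trivially write `∏ G_i H_i = (1/C(v,v/2)) Σ_T (…)(…)`"). [cite: KauersODonnellTanZhou2012, proof of Lemma 3.3 (p. 9)] -/
theorem halfProd_mul_halfProd_sdiff (G H : ι → MvPolynomial σ ℝ) {V T : Finset ι} (hT : T ⊆ V) :
    halfProd G H V T * halfProd G H V (V \ T) = ∏ i ∈ V, (G i * H i) := by
  unfold halfProd
  rw [Finset.sdiff_sdiff_eq_self hT, prod_mul_distrib, ← prod_sdiff hT (f := G), ← prod_sdiff hT (f := H)]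
  ring

/-- **KOTZ Lemma 3.3 in identity form**: for `|V| = 2t`,
`2·C(2t,t)·∏_{i∈V} G_i H_i = 2 Σ_T P_T² − Σ_T (P_T − P_{V∖T})²`, `T` over the `t`-subsets of `V` (the printed
proof: pair `T` with its complement and apply `⊢₂ XY ≤ ½X² + ½Y²`, whose slack is `½(X−Y)²`).
[cite: KauersODonnellTanZhou2012, Lemma 3.3 and its proof (p. 9)] -/
theorem amgm_identity (G H : ι → MvPolynomial σ ℝ) {V : Finset ι} {t : ℕ} (hV : #V = 2 * t) :
    (2 * ((2 * t).choose t : MvPolynomial σ ℝ)) * ∏ i ∈ V, (G i * H i) =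
      2 * ∑ T ∈ powersetCard t V, halfProd G H V T ^ 2 -
        ∑ T ∈ powersetCard t V, (halfProd G H V T - halfProd G H V (V \ T)) ^ 2 := by
  have hmem : ∀ T ∈ powersetCard t V, V \ T ∈ powersetCard t V := by
    intro T hT
    rw [mem_powersetCard] at hT ⊢
    refine ⟨sdiff_subset, ?_⟩
    rw [card_sdiff_of_subset hT.1]; omega
  have hinv : ∑ T ∈ powersetCard t V, halfProd G H V (V \ T) ^ 2 =
      ∑ T ∈ powersetCard t V, halfProd G H V T ^ 2 := by
    refine sum_nbij' (fun T => V \ T) (fun T => V \ T) hmem hmem ?_ ?_ ?_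
    · intro T hT; exact Finset.sdiff_sdiff_eq_self (mem_powersetCard.1 hT).1
    · intro T hT; exact Finset.sdiff_sdiff_eq_self (mem_powersetCard.1 hT).1
    · intro T _; rfl
  have hcross : ∑ T ∈ powersetCard t V, halfProd G H V T * halfProd G H V (V \ T) =
      ((2 * t).choose t : MvPolynomial σ ℝ) * ∏ i ∈ V, (G i * H i) := by
    rw [sum_congr rfl fun T hT => halfProd_mul_halfProd_sdiff G H (mem_powersetCard.1 hT).1, sum_const,
      card_powersetCard, hV, nsmul_eq_mul]
  have hsq : ∑ T ∈ powersetCard t V, (halfProd G H V T - halfProd G H V (V \ T)) ^ 2 =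
      ∑ T ∈ powersetCard t V, (halfProd G H V T ^ 2 + halfProd G H V (V \ T) ^ 2 -
        2 * (halfProd G H V T * halfProd G H V (V \ T))) :=
    sum_congr rfl fun _ _ => by ring
  rw [hsq, sum_sub_distrib, sum_add_distrib, hinv, ← mul_sum, hcross]
  ring

/-! #### Reindexing toolkit -/

section Toolkit
variable {M : Type*} [AddCommMonoid M]

/-- `Σ_{V ⊆ X} Σ_{T ⊆ V} f V T = Σ_{T ⊆ X} Σ_{V ⊆ X, T ⊆ V} f V T`. [folklore] -/
private theorem sum_powerset_powerset_comm (X : Finset ι) (f : Finset ι → Finset ι → M) :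
    ∑ V ∈ X.powerset, ∑ T ∈ V.powerset, f V T =
      ∑ T ∈ X.powerset, ∑ V ∈ X.powerset with T ⊆ V, f V T := by
  have h1 : ∀ V ∈ X.powerset, ∑ T ∈ V.powerset, f V T =
      ∑ T ∈ X.powerset, if T ⊆ V then f V T else 0 := by
    intro V hV
    rw [← sum_filter]
    congr 1
    ext T
    simp only [mem_powerset, mem_filter]
    exact ⟨fun h => ⟨h.trans (mem_powerset.1 hV), h⟩, fun h => h.2⟩
  rw [sum_congr rfl h1, sum_comm]
  refine sum_congr rfl fun T _ => ?_
  rw [sum_filter]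

/-- `Σ_{A ⊆ X} Σ_{B ⊆ X∖A} h A B = Σ_{B ⊆ X} Σ_{A ⊆ X∖B} h A B` (ordered pairs of disjoint subsets). [folklore] -/
private theorem sum_powerset_sdiff_comm (X : Finset ι) (h : Finset ι → Finset ι → M) :
    ∑ A ∈ X.powerset, ∑ B ∈ (X \ A).powerset, h A B =
      ∑ B ∈ X.powerset, ∑ A ∈ (X \ B).powerset, h A B := by
  have key : ∀ (A : Finset ι) (g : Finset ι → M),
      ∑ B ∈ (X \ A).powerset, g B = ∑ B ∈ X.powerset, if Disjoint A B then g B else 0 := by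
    intro A g
    rw [← sum_filter]
    congr 1
    ext B
    simp only [mem_powerset, mem_filter, subset_sdiff, disjoint_comm]
  rw [sum_congr rfl fun A _ => key A (h A), sum_comm]
  refine sum_congr rfl fun B _ => ?_
  rw [key B (fun A => h A B)]
  refine sum_congr rfl fun A _ => ?_
  by_cases hAB : Disjoint A B
  · rw [if_pos hAB, if_pos hAB.symm]
  · rw [if_neg hAB, if_neg fun h' => hAB h'.symm]

/-- Supersets of `T` inside `X` are `T ∪ T'`, `T' ⊆ X ∖ T`. [folklore] -/
private theorem sum_powerset_filter_superset (X T : Finset ι) (hT : T ⊆ X) (g : Finset ι → M) :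
    ∑ V ∈ X.powerset with T ⊆ V, g V = ∑ T' ∈ (X \ T).powerset, g (T ∪ T') := by
  refine sum_nbij' (fun V => V \ T) (fun T' => T ∪ T') ?_ ?_ ?_ ?_ ?_
  · intro V hV
    simp only [mem_filter, mem_powerset] at hV ⊢
    exact sdiff_subset_sdiff hV.1 subset_rfl
  · intro T' hT'
    simp only [mem_filter, mem_powerset] at hT' ⊢
    exact ⟨union_subset hT ((hT'.trans sdiff_subset)), subset_union_left⟩
  · intro V hV
    simp only [mem_filter, mem_powerset] at hV
    exact union_sdiff_of_subset hV.2
  · intro T' hT'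
    simp only [mem_powerset, subset_sdiff] at hT'
    exact union_sdiff_cancel_left hT'.2.symm
  · intro V hV
    simp only [mem_filter, mem_powerset] at hV
    rw [union_sdiff_of_subset hV.2]

/-- Complementation inside `Y` is a bijection of its subsets. [folklore] -/
private theorem sum_powerset_sdiff_reindex (Y : Finset ι) (g : Finset ι → M) :
    ∑ W ∈ Y.powerset, g (Y \ W) = ∑ A ∈ Y.powerset, g A := by
  refine sum_nbij' (fun W => Y \ W) (fun A => Y \ A) ?_ ?_ ?_ ?_ ?_
  · intro W _; exact mem_powerset.2 sdiff_subset
  · intro A _; exact mem_powerset.2 sdiff_subset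
  · intro W hW; exact Finset.sdiff_sdiff_eq_self (mem_powerset.1 hW)
  · intro A hA; exact Finset.sdiff_sdiff_eq_self (mem_powerset.1 hA)
  · intro W _; rfl

/-- Two ranges agree on a function vanishing beyond both. [folklore] -/
private theorem sum_range_eq_of_vanish (a b : ℕ) (f : ℕ → M) (ha : ∀ t, a < t → f t = 0) (hb : ∀ t, b < t → f t = 0) :
    ∑ t ∈ range (a + 1), f t = ∑ t ∈ range (b + 1), f t := by
  have h1 : ∑ t ∈ range (a + 1), f t = ∑ t ∈ range (a + b + 1), f t :=
    sum_subset (range_subset_range.2 (by omega)) fun t _ ht => ha t (by simpa [mem_range, Nat.lt_succ_iff] using ht)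
  have h2 : ∑ t ∈ range (b + 1), f t = ∑ t ∈ range (a + b + 1), f t :=
    sum_subset (range_subset_range.2 (by omega)) fun t _ ht => hb t (by simpa [mem_range, Nat.lt_succ_iff] using ht)
  rw [h1, h2]

end Toolkit

/-! #### B1: expanding `∏ (H_i ± G_i)²` -/

variable [Fintype ι]

/-- The common core term `∏_{i∈W} H_i² · ∏_{i∈(univ∖W)∖V} G_i² · ∏_{i∈V} G_i H_i` of the expansion
of `∏_i (H_i ± G_i)²` over the partitions `(U,V,W)` of the index set (`U = (univ∖W)∖V`).
[cite: KauersODonnellTanZhou2012, proof of Thm. 3.4, eq. (4) (p. 10)] -/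
def core (G H : ι → MvPolynomial σ ℝ) (W V : Finset ι) : MvPolynomial σ ℝ :=
  (∏ i ∈ W, H i ^ 2) * (∏ i ∈ (univ \ W) \ V, G i ^ 2) * ∏ i ∈ V, (G i * H i)

omit [DecidableEq ι] [Fintype ι] in
/-- `∏_{i∈s} c·f_i = c^{|s|} ∏_{i∈s} f_i`. [folklore] -/
private theorem prod_C_mul (c : ℝ) (f : ι → MvPolynomial σ ℝ) (s : Finset ι) :
    ∏ i ∈ s, C c * f i = C c ^ #s * ∏ i ∈ s, f i := by
  rw [prod_mul_distrib, prod_const]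

/-- `∏_i (H_i + εG_i)² = Σ_W Σ_{V ⊆ univ∖W} (2ε)^{|V|} (ε²)^{|U|} · core` — the expansion over the
partitions `(U,V,W)`. [cite: KauersODonnellTanZhou2012, proof of Thm. 3.4, eq. (4) (p. 10)] -/
theorem prod_sq_expand (G H : ι → MvPolynomial σ ℝ) (ε : ℝ) :
    ∏ i, (H i + C ε * G i) ^ 2 =
      ∑ W ∈ (univ : Finset ι).powerset, ∑ V ∈ (univ \ W).powerset,
        C ((2 * ε) ^ #V) * (C (ε ^ 2) ^ #((univ \ W) \ V) * core G H W V) := by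
  have h1 : ∀ i, (H i + C ε * G i) ^ 2 = H i ^ 2 + (C (2 * ε) * (G i * H i) + C (ε ^ 2) * G i ^ 2) := by
    intro i; rw [map_mul, map_pow, map_ofNat]; ring
  simp_rw [h1]
  rw [prod_add]
  refine sum_congr rfl fun W _ => ?_
  rw [prod_add, mul_sum]
  refine sum_congr rfl fun V _ => ?_
  rw [prod_C_mul, prod_C_mul, ← map_pow, core]
  ring

/-- **Averaging over the sign of the split variable**: `∏_i (H_i+G_i)² + ∏_i (H_i−G_i)² =
Σ_W Σ_{V ⊆ univ∖W, |V| even} 2·2^{|V|}·core` ("using the fact that `x_n` … has zero odd moments": eq. (4)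
for a uniform `±1` bit, times `2`). [cite: KauersODonnellTanZhou2012, proof of Thm. 3.4, eq. (4) (p. 10)] -/
theorem twoPoint_expand (G H : ι → MvPolynomial σ ℝ) :
    ∏ i, (H i + G i) ^ 2 + ∏ i, (H i - G i) ^ 2 =
      ∑ W ∈ (univ : Finset ι).powerset, ∑ V ∈ (univ \ W).powerset with Even #V,
        C (2 * 2 ^ #V) * core G H W V := by
  have hp : ∏ i, (H i + G i) ^ 2 = ∏ i, (H i + C (1 : ℝ) * G i) ^ 2 := by simp
  have hm : ∏ i, (H i - G i) ^ 2 = ∏ i, (H i + C (-1 : ℝ) * G i) ^ 2 := by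
    simp [sub_eq_add_neg]
  rw [hp, hm, prod_sq_expand, prod_sq_expand, ← sum_add_distrib]
  refine sum_congr rfl fun W _ => ?_
  rw [sum_filter, ← sum_add_distrib]
  refine sum_congr rfl fun V _ => ?_
  simp only [mul_one, one_pow, map_one, one_mul, neg_one_sq]
  split_ifs with h
  · rw [mul_pow, Even.neg_one_pow h, mul_one, ← add_mul, ← map_add]
    congr 2; ring
  · rw [mul_pow, Odd.neg_one_pow (Nat.not_even_iff_odd.1 h), mul_neg_one, map_neg, neg_mul,
      add_neg_cancel]






/-! #### B4: regrouping the main terms by `A = ((univ∖W)∖V) ∪ T` -/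


omit [Fintype ι] in
/-- `X ∖ (T ∪ T') ∪ T = X ∖ T'` for `T ⊆ X` disjoint from `T'`. [folklore] -/
private theorem sdiff_union_eq {X T T' : Finset ι} (hT : T ⊆ X) (hTT' : Disjoint T T') :
    X \ (T ∪ T') ∪ T = X \ T' := by
  ext i
  simp only [mem_union, mem_sdiff, not_or]
  constructor
  · rintro (⟨hx, -, h'⟩ | h)
    · exact ⟨hx, h'⟩
    · exact ⟨hT h, fun h' => disjoint_left.1 hTT' h h'⟩
  · rintro ⟨hx, h'⟩
    by_cases h : i ∈ T
    · exact Or.inr h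
    · exact Or.inl ⟨hx, h, h'⟩

/-- **Regrouping by `R = U ∪ T`** ("By symmetry, and taking the sum over `v` first in (5), it suffices
to check that for each `r = |R| = |U ∪ T|` …"): the triple sum over `(W, V, T)` of `φ(|V|/2)·m(U ∪ T)`,
`U = (univ∖W)∖V`, equals `Σ_R (Σ_t C(|ι|−|R|,t) C(|R|,t) φ(t))·m(R)` — via the bijection
`(W,V,T) ↦ (R, T, V∖T)` (`T ⊆ R`, `V∖T ⊆ univ∖R`, `|T| = |V∖T|`). [cite: KauersODonnellTanZhou2012, proof of Thm. 3.4 (p. 10)] -/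
theorem reindex_main (φ : ℕ → MvPolynomial σ ℝ) (m : Finset ι → MvPolynomial σ ℝ) :
    ∑ W ∈ (univ : Finset ι).powerset, ∑ V ∈ (univ \ W).powerset with Even #V,
        ∑ T ∈ powersetCard (#V / 2) V, φ (#V / 2) * m ((univ \ W) \ V ∪ T) =
      ∑ A ∈ (univ : Finset ι).powerset,
        (∑ t ∈ range (Fintype.card ι - #A + 1), ((Fintype.card ι - #A).choose t * (#A).choose t) • φ t) * m A := by
  -- Step 1: the inner double sum, for a fixed `W`, with `X = univ \ W`
  have step1 : ∀ X : Finset ι,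
      ∑ V ∈ X.powerset with Even #V, ∑ T ∈ powersetCard (#V / 2) V, φ (#V / 2) * m (X \ V ∪ T) =
        ∑ T' ∈ X.powerset, (#(X \ T')).choose #T' • (φ #T' * m (X \ T')) := by
    intro X
    -- (a) as a sum over pairs `T ⊆ V ⊆ X` with `#V = 2 #T`
    have ha : ∑ V ∈ X.powerset with Even #V, ∑ T ∈ powersetCard (#V / 2) V, φ (#V / 2) * m (X \ V ∪ T) =
        ∑ V ∈ X.powerset, ∑ T ∈ V.powerset, if #V = 2 * #T then φ #T * m (X \ V ∪ T) else 0 := by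
      rw [sum_filter]
      refine sum_congr rfl fun V _ => ?_
      split_ifs with hV
      · rw [powersetCard_eq_filter, sum_filter]
        refine sum_congr rfl fun T _ => ?_
        obtain ⟨k, hk⟩ := hV
        have hk2 : #V / 2 = k := by omega
        by_cases hT : #T = #V / 2
        · rw [if_pos hT, if_pos (by omega), hT, hk2]
        · rw [if_neg hT, if_neg (by omega)]
      · symm
        refine sum_eq_zero fun T _ => ?_
        rw [if_neg]
        intro h
        exact hV ⟨#T, by omega⟩
    rw [ha, sum_powerset_powerset_comm]
    -- (b) supersets of `T` as `T ∪ T'`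
    have hb : ∀ T ∈ X.powerset,
        ∑ V ∈ X.powerset with T ⊆ V, (if #V = 2 * #T then φ #T * m (X \ V ∪ T) else 0) =
          ∑ T' ∈ (X \ T).powerset, if #T' = #T then φ #T * m (X \ T') else 0 := by
      intro T hT
      rw [sum_powerset_filter_superset X T (mem_powerset.1 hT)]
      refine sum_congr rfl fun T' hT' => ?_
      have hd : Disjoint T T' := (subset_sdiff.1 (mem_powerset.1 hT')).2.symm
      rw [card_union_of_disjoint hd, sdiff_union_eq (mem_powerset.1 hT) hd]
      by_cases h : #T' = #T
      · rw [if_pos h, if_pos (by omega)]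
      · rw [if_neg h, if_neg (by omega)]
    rw [sum_congr rfl hb, sum_powerset_sdiff_comm]
    -- (c) count the `T` of size `#T'` inside `X \ T'`
    refine sum_congr rfl fun T' _ => ?_
    have hflip : ∀ T ∈ (X \ T').powerset, (if #T' = #T then φ #T * m (X \ T') else 0) =
        if #T = #T' then φ #T' * m (X \ T') else 0 := by
      intro T _
      by_cases h : #T = #T'
      · rw [if_pos h, if_pos h.symm, h]
      · rw [if_neg h, if_neg fun h' => h h'.symm]
    rw [sum_congr rfl hflip, ← sum_filter, ← powersetCard_eq_filter, sum_const, card_powersetCard]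
  -- Step 2: the outer sum
  rw [sum_congr rfl fun W _ => step1 (univ \ W), sum_powerset_sdiff_comm]
  have hc : ∀ T' ∈ (univ : Finset ι).powerset,
      ∑ W ∈ (univ \ T').powerset, (#((univ \ W) \ T')).choose #T' • (φ #T' * m ((univ \ W) \ T')) =
        ∑ A ∈ (univ \ T').powerset, (#A).choose #T' • (φ #T' * m A) := by
    intro T' _
    rw [← sum_powerset_sdiff_reindex (univ \ T') fun A => (#A).choose #T' • (φ #T' * m A)]
    refine sum_congr rfl fun W _ => ?_
    rw [sdiff_right_comm]
  rw [sum_congr rfl hc, ← sum_powerset_sdiff_comm]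
  refine sum_congr rfl fun A _ => ?_
  rw [sum_mul]
  simp_rw [smul_mul_assoc]
  rw [sum_powerset_apply_card (fun k => (#A).choose k • (φ k * m A)), card_univ_sdiff]
  refine sum_congr rfl fun t _ => ?_
  rw [smul_smul]





/-! #### B3: the one-variable decomposition -/

/-- `M_A = ∏_{i∈A} G_i · ∏_{i∉A} H_i`; the main terms of the induction step are the `M_A²`. [cite: KauersODonnellTanZhou2012, proof of Thm. 3.4, eq. (5) (p. 10)] -/
def monoProd (G H : ι → MvPolynomial σ ℝ) (A : Finset ι) : MvPolynomial σ ℝ := (∏ i ∈ A, G i) * ∏ i ∈ univ \ A, H i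

/-- The base `∏_{i∈W} H_i · ∏_{i∈U} G_i · (P_T − P_{V∖T})` of a square discarded by the AM–GM step. [cite: KauersODonnellTanZhou2012, proof of Thm. 3.4 (p. 10: "notice that each is multiplied against an SOS polynomial")] -/
def remBase (G H : ι → MvPolynomial σ ℝ) (W V T : Finset ι) : MvPolynomial σ ℝ :=
  (∏ i ∈ W, H i) * (∏ i ∈ (univ \ W) \ V, G i) * (halfProd G H V T - halfProd G H V (V \ T))

/-- **The explicit sum of squares discarded by the AM–GM steps** of the one-variable decomposition:
`Σ_W Σ_{V even} Σ_T (4^{|V|/2}/C(|V|,|V|/2)) · (∏_W H · ∏_U G · (P_T − P_{V∖T}))²`.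
[cite: KauersODonnellTanZhou2012, proof of Thm. 3.4 (p. 10)] -/
def rem (G H : ι → MvPolynomial σ ℝ) : MvPolynomial σ ℝ :=
  ∑ W ∈ (univ : Finset ι).powerset, ∑ V ∈ (univ \ W).powerset with Even #V,
    ∑ T ∈ powersetCard (#V / 2) V, C ((4 : ℝ) ^ (#V / 2) / (#V).choose (#V / 2)) * remBase G H W V T ^ 2

/-- The coefficient of `M_A²` (`|A| = r`) after regrouping: `2κ_s(r) = Σ_t C(s−r,t) C(r,t) · 2·4^t/C(2t,t)`
(`coef_eq_two_mul_kap`). [cite: KauersODonnellTanZhou2012, proof of Thm. 3.4, eq. (5)–(6) (p. 10)] -/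
def coef (s r : ℕ) : ℝ :=
  ∑ t ∈ range (s - r + 1), ((s - r).choose t * r.choose t : ℕ) * (2 * ((4 : ℝ) ^ t / (2 * t).choose t))

/-- `2κ ≥ 0`. [folklore] -/
private theorem coef_nonneg (s r : ℕ) : 0 ≤ coef s r :=
  sum_nonneg fun t _ => by positivity

omit [Fintype ι] in
/-- `X ∖ V` is disjoint from every `T ⊆ V`. [folklore] -/
private theorem disj₁ {X V T : Finset ι} (hT : T ⊆ V) : Disjoint (X \ V) T :=
  disjoint_left.2 fun _ hi hiT => (mem_sdiff.1 hi).2 (hT hiT)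

/-- The complement of `U ∪ T` is `W ∪ (V ∖ T)`. [folklore] -/
private theorem compl_eq {W V T : Finset ι} (hV : V ⊆ univ \ W) (hT : T ⊆ V) :
    univ \ ((univ \ W) \ V ∪ T) = W ∪ (V \ T) := by
  ext i
  have h1 : i ∈ V → i ∉ W := fun h => (mem_sdiff.1 (hV h)).2
  have h2 : i ∈ T → i ∈ V := fun h => hT h
  simp only [mem_sdiff, mem_univ, true_and, mem_union, not_or, not_and, not_not]
  tauto

/-- `W` is disjoint from `V ∖ T` when `V ⊆ univ ∖ W`. [folklore] -/
private theorem disj₂ {W V T : Finset ι} (hV : V ⊆ univ \ W) : Disjoint W (V \ T) :=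
  disjoint_left.2 fun _ hiW hi => (mem_sdiff.1 (hV (mem_sdiff.1 hi).1)).2 hiW

/-- The main terms are squares of mixed monomials: `∏_W H² · ∏_U G² · P_T² = M_{U∪T}²`. [cite: KauersODonnellTanZhou2012, proof of Thm. 3.4, eq. (5) (p. 10)] -/
theorem monoProd_sq_eq (G H : ι → MvPolynomial σ ℝ) {W V T : Finset ι} (hV : V ⊆ univ \ W) (hT : T ⊆ V) :
    (∏ i ∈ W, H i ^ 2) * (∏ i ∈ (univ \ W) \ V, G i ^ 2) * halfProd G H V T ^ 2 =
      monoProd G H ((univ \ W) \ V ∪ T) ^ 2 := by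
  rw [monoProd, compl_eq hV hT, prod_union (disj₁ hT), prod_union (disj₂ hV), halfProd,
    prod_pow, prod_pow]
  ring

/-- `2·4^t = (4^t/C(2t,t))·(2 C(2t,t))` in the coefficient ring. [folklore] -/
private theorem C_two_mul_four_pow (t : ℕ) :
    (C (2 * (4 : ℝ) ^ t) : MvPolynomial σ ℝ) = C ((4 : ℝ) ^ t / (2 * t).choose t) * (2 * ((2 * t).choose t : MvPolynomial σ ℝ)) := by
  have hc : ((2 * t).choose t : ℝ) ≠ 0 := by exact_mod_cast (Nat.choose_pos (by omega)).ne'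
  rw [show (2 * ((2 * t).choose t : MvPolynomial σ ℝ)) = C (2 * ((2 * t).choose t : ℝ)) by
    rw [map_mul, map_natCast, map_ofNat], ← map_mul]
  congr 1
  field_simp

/-- The discarded squares, expanded. [folklore] -/
private theorem remBase_sq (G H : ι → MvPolynomial σ ℝ) (W V T : Finset ι) :
    remBase G H W V T ^ 2 = (∏ i ∈ W, H i ^ 2) * (∏ i ∈ (univ \ W) \ V, G i ^ 2) *
      (halfProd G H V T - halfProd G H V (V \ T)) ^ 2 := by
  rw [remBase, mul_pow, mul_pow, ← prod_pow, ← prod_pow]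

omit [DecidableEq ι] [Fintype ι] in
/-- Distributing a constant and a common factor over the two sums of Lemma 3.3. [folklore] -/
private theorem distrib_helper (c : ℝ) (P : MvPolynomial σ ℝ) (s : Finset (Finset ι)) (f g : Finset ι → MvPolynomial σ ℝ) :
    C c * P * (2 * ∑ T ∈ s, f T - ∑ T ∈ s, g T) =
      ∑ T ∈ s, C (2 * c) * (P * f T) - ∑ T ∈ s, C c * (P * g T) := by
  have h1 : C c * P * (2 * ∑ T ∈ s, f T) = ∑ T ∈ s, C (2 * c) * (P * f T) := by
    rw [← mul_assoc, mul_sum]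
    refine sum_congr rfl fun T _ => ?_
    rw [map_mul, map_ofNat]; ring
  have h2 : C c * P * ∑ T ∈ s, g T = ∑ T ∈ s, C c * (P * g T) := by
    rw [mul_sum]
    exact sum_congr rfl fun T _ => by ring
  rw [mul_sub, h1, h2]

/-- **The AM–GM step inside one core term** ("We apply Lemma 3.3 to each `∏_{i∈V} G̃_i H̃_i` (notice
that each is multiplied against an SOS polynomial)"): for `|V| = 2t`,
`2·2^{|V|}·core = Σ_T (2·4^t/C(2t,t))·M_{U∪T}² − Σ_T (4^t/C(2t,t))·remBase_T²`.
[cite: KauersODonnellTanZhou2012, proof of Thm. 3.4, eq. (4)–(5) (p. 10)] -/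
theorem core_step (G H : ι → MvPolynomial σ ℝ) {W V : Finset ι} (hV : V ⊆ univ \ W) {t : ℕ} (ht : #V = 2 * t) :
    C (2 * 2 ^ #V) * core G H W V =
      ∑ T ∈ powersetCard t V, C (2 * ((4 : ℝ) ^ t / (2 * t).choose t)) * monoProd G H ((univ \ W) \ V ∪ T) ^ 2 -
        ∑ T ∈ powersetCard t V, C ((4 : ℝ) ^ t / (2 * t).choose t) * remBase G H W V T ^ 2 := by
  have h4 : (2 : ℝ) * 2 ^ #V = 2 * 4 ^ t := by
    rw [ht, pow_mul]; norm_num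
  rw [h4, C_two_mul_four_pow, core]
  have e1 : C ((4 : ℝ) ^ t / (2 * t).choose t) * (2 * ((2 * t).choose t : MvPolynomial σ ℝ)) *
      ((∏ i ∈ W, H i ^ 2) * (∏ i ∈ (univ \ W) \ V, G i ^ 2) * ∏ i ∈ V, (G i * H i)) =
      C ((4 : ℝ) ^ t / (2 * t).choose t) * ((∏ i ∈ W, H i ^ 2) * (∏ i ∈ (univ \ W) \ V, G i ^ 2)) *
        ((2 * ((2 * t).choose t : MvPolynomial σ ℝ)) * ∏ i ∈ V, (G i * H i)) := by ring
  have hs1 : ∑ T ∈ powersetCard t V, C (2 * ((4 : ℝ) ^ t / (2 * t).choose t)) *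
      (((∏ i ∈ W, H i ^ 2) * (∏ i ∈ (univ \ W) \ V, G i ^ 2)) * halfProd G H V T ^ 2) =
      ∑ T ∈ powersetCard t V, C (2 * ((4 : ℝ) ^ t / (2 * t).choose t)) *
        monoProd G H ((univ \ W) \ V ∪ T) ^ 2 :=
    sum_congr rfl fun T hT => by rw [← monoProd_sq_eq G H hV (mem_powersetCard.1 hT).1, mul_assoc]
  have hs2 : ∑ T ∈ powersetCard t V, C ((4 : ℝ) ^ t / (2 * t).choose t) *
      (((∏ i ∈ W, H i ^ 2) * (∏ i ∈ (univ \ W) \ V, G i ^ 2)) *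
        (halfProd G H V T - halfProd G H V (V \ T)) ^ 2) =
      ∑ T ∈ powersetCard t V, C ((4 : ℝ) ^ t / (2 * t).choose t) * remBase G H W V T ^ 2 :=
    sum_congr rfl fun T _ => by rw [remBase_sq, mul_assoc]
  rw [e1, amgm_identity G H ht, distrib_helper, hs1, hs2]

/-- **The one-variable decomposition** (Theorem 3.4 for `n = 1` with polynomial coefficients, all
squares explicit): `∏_i (H_i+G_i)² + ∏_i (H_i−G_i)² + rem = Σ_A 2κ_{|ι|}(|A|)·M_A²`.  This is the content of
the induction step of the printed proof (eq. (4) → Lemma 3.3 → eq. (5) → regrouping), isolated from the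
induction hypothesis. [cite: KauersODonnellTanZhou2012, proof of Thm. 3.4 (p. 10)] -/
theorem one_variable (G H : ι → MvPolynomial σ ℝ) :
    ∏ i, (H i + G i) ^ 2 + ∏ i, (H i - G i) ^ 2 + rem G H =
      ∑ A ∈ (univ : Finset ι).powerset, C (coef (Fintype.card ι) #A) * monoProd G H A ^ 2 := by
  have hmain : ∏ i, (H i + G i) ^ 2 + ∏ i, (H i - G i) ^ 2 =
      (∑ W ∈ (univ : Finset ι).powerset, ∑ V ∈ (univ \ W).powerset with Even #V,
        ∑ T ∈ powersetCard (#V / 2) V,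
          C (2 * ((4 : ℝ) ^ (#V / 2) / (2 * (#V / 2)).choose (#V / 2))) * monoProd G H ((univ \ W) \ V ∪ T) ^ 2) -
      rem G H := by
    rw [twoPoint_expand, rem, ← sum_sub_distrib]
    refine sum_congr rfl fun W _ => ?_
    rw [← sum_sub_distrib]
    refine sum_congr rfl fun V hV => ?_
    obtain ⟨hV, hev⟩ := mem_filter.1 hV
    obtain ⟨t, ht⟩ := hev
    have ht' : #V = 2 * t := by omega
    have h2 : #V / 2 = t := by omega
    rw [core_step G H (mem_powerset.1 hV) ht', h2, ht']
  rw [hmain, sub_add_cancel,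
    reindex_main (fun t => C (2 * ((4 : ℝ) ^ t / (2 * t).choose t))) (fun A => monoProd G H A ^ 2)]
  refine sum_congr rfl fun A _ => ?_
  congr 1
  rw [coef, map_sum]
  refine sum_congr rfl fun t _ => ?_
  rw [nsmul_eq_mul, ← map_natCast (C : ℝ →+* MvPolynomial σ ℝ), ← map_mul]

/-! #### Degrees: every square in `rem` has degree `≤ |ι|` when the `G_i, H_i` are linear -/

omit [DecidableEq ι] [Fintype ι] in
/-- A product of `|s|` linear polynomials has degree `≤ |s|`. [folklore] -/
private theorem totalDegree_prod_le_card {F : ι → MvPolynomial σ ℝ} (hF : ∀ i, (F i).totalDegree ≤ 1) (s : Finset ι) :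
    (∏ i ∈ s, F i).totalDegree ≤ #s :=
  (totalDegree_finsetProd _ _).trans ((sum_le_sum fun i _ => hF i).trans (by simp))

omit [Fintype ι] in
/-- `deg P_T ≤ |V|`. [folklore] -/
private theorem totalDegree_halfProd_le {G H : ι → MvPolynomial σ ℝ} (hG : ∀ i, (G i).totalDegree ≤ 1)
    (hH : ∀ i, (H i).totalDegree ≤ 1) {V T : Finset ι} (hT : T ⊆ V) :
    (halfProd G H V T).totalDegree ≤ #V := by
  unfold halfProd
  refine (totalDegree_mul _ _).trans ?_
  have := card_sdiff_of_subset hT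
  have := card_le_card hT
  have h1 := totalDegree_prod_le_card hG T
  have h2 := totalDegree_prod_le_card hH (V \ T)
  omega

/-- The bases of the discarded squares have degree `≤ |ι|` (`|W| + |U| + |V| = |ι|`). [cite: KauersODonnellTanZhou2012, §2 (p. 7: "`⊢_k p ≥ 0`") and proof of Thm. 3.4 (p. 10)] -/
theorem totalDegree_remBase_le {G H : ι → MvPolynomial σ ℝ} (hG : ∀ i, (G i).totalDegree ≤ 1)
    (hH : ∀ i, (H i).totalDegree ≤ 1) {W V T : Finset ι} (hV : V ⊆ univ \ W) (hT : T ⊆ V) :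
    (remBase G H W V T).totalDegree ≤ Fintype.card ι := by
  unfold remBase
  have h1 := totalDegree_prod_le_card hH W
  have h2 := totalDegree_prod_le_card hG ((univ \ W) \ V)
  have h3 : (halfProd G H V T - halfProd G H V (V \ T)).totalDegree ≤ #V :=
    (totalDegree_sub _ _).trans (max_le (totalDegree_halfProd_le hG hH hT)
      (totalDegree_halfProd_le hG hH sdiff_subset))
  have hc1 : #((univ \ W) \ V) = #(univ \ W) - #V := card_sdiff_of_subset hV
  have hc2 : #(univ \ W) = Fintype.card ι - #W := by rw [card_univ_sdiff]
  have hc3 := card_le_card hV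
  have hc4 : #W ≤ Fintype.card ι := card_le_univ W
  refine (totalDegree_mul _ _).trans ?_
  refine (add_le_add (totalDegree_mul _ _) h3).trans ?_
  omega

/-- `rem` is a sum of squares of polynomials of degree `≤ |ι|` when the `G_i, H_i` are linear. [cite: KauersODonnellTanZhou2012, proof of Thm. 3.4 (p. 10)] -/
theorem isSosDeg_rem {G H : ι → MvPolynomial σ ℝ} (hG : ∀ i, (G i).totalDegree ≤ 1) (hH : ∀ i, (H i).totalDegree ≤ 1) :
    IsSosDeg (Fintype.card ι) (rem G H) := by
  refine IsSosDeg.sum _ fun W _ => IsSosDeg.sum _ fun V hV => IsSosDeg.sum _ fun T hT => ?_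
  refine (IsSosDeg.sq ?_).const_mul (by positivity)
  exact totalDegree_remBase_le hG hH (mem_powerset.1 (mem_filter.1 hV).1) (mem_powersetCard.1 hT).1


end OneVariable

/-! ### §3 The induction on the number of variables (KOTZ Thm 3.4, proof p. 8–9) -/

section Induction

variable {σ : Type*} {ι : Type*} [DecidableEq ι] [Fintype ι] {n : ℕ}

/-- `‖T_{√w} f‖₂² = Σ_S w^{|S|} f̂(S)²`, the weighted square norm driving the induction
(`w = 2s − 1 = 1/ρ²`; for `s = 2` this is `sqNorm3`). [cite: KauersODonnellTanZhou2012, Thm. 3.4 (p. 8)] -/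
def sqNormW (w : ℝ) (a : Finset (Fin n) → MvPolynomial σ ℝ) : MvPolynomial σ ℝ :=
  ∑ S, C (w ^ S.card) * a S ^ 2

omit [DecidableEq ι] [Fintype ι] in
/-- Subsets of an embedded copy are the embedded copies of subsets. [folklore] -/
private theorem powerset_map_eq' {α β : Type*} [DecidableEq β] (e : α ↪ β) (s : Finset α) :
    (s.map e).powerset = s.powerset.map (Finset.mapEmbedding e).toEmbedding := by
  ext t
  simp only [Finset.mem_powerset, Finset.mem_map, RelEmbedding.coe_toEmbedding,
    Finset.mapEmbedding_apply]
  constructor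
  · intro h
    obtain ⟨u, hu, rfl⟩ := Finset.subset_map_iff.1 h
    exact ⟨u, hu, rfl⟩
  · rintro ⟨u, hu, rfl⟩
    exact Finset.map_subset_map.2 hu

omit [DecidableEq ι] [Fintype ι] in
/-- `Σ_{S ⊆ [n+1]} F(S) = Σ_{T ⊆ [n]} (F(T⁺) + F({0} ∪ T⁺))`. [folklore] -/
private theorem sum_finset_succ' {β : Type*} [AddCommMonoid β] (F : Finset (Fin (n + 1)) → β) :
    ∑ S, F S = ∑ T : Finset (Fin n), (F (T.map (Fin.succEmb n)) + F (insert 0 (T.map (Fin.succEmb n)))) := by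
  classical
  have h0 : (0 : Fin (n + 1)) ∉ (Finset.univ : Finset (Fin n)).map (Fin.succEmb n) := by
    simp only [Finset.mem_map, Finset.mem_univ, true_and, not_exists]
    exact fun i => Fin.succ_ne_zero i
  have huniv : (Finset.univ : Finset (Fin (n + 1))) =
      insert 0 ((Finset.univ : Finset (Fin n)).map (Fin.succEmb n)) := by
    rw [Fin.univ_succ, Finset.cons_eq_insert]
    rfl
  rw [← Finset.powerset_univ, huniv, Finset.sum_powerset_insert h0, powerset_map_eq',
    Finset.sum_map, Finset.sum_map, Finset.powerset_univ, ← Finset.sum_add_distrib]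
  rfl

omit [DecidableEq ι] [Fintype ι] in
/-- `Σ_{x ∈ {0,1}^{n+1}} F(x) = Σ_{y ∈ {0,1}ⁿ} (F(0,y) + F(1,y))`. [folklore] -/
private theorem sum_cube_succ' {β : Type*} [AddCommMonoid β] (F : (Fin (n + 1) → Bool) → β) :
    ∑ x, F x = ∑ y : Fin n → Bool, (F (Fin.cons false y) + F (Fin.cons true y)) := by
  rw [← Fintype.sum_equiv (Fin.consEquiv fun _ : Fin (n + 1) => Bool) (fun p => F (Fin.cons p.1 p.2)) F
    (fun p => rfl), Fintype.sum_prod_type, Fintype.sum_bool, ← sum_add_distrib]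
  exact sum_congr rfl fun y _ => add_comm _ _

omit [DecidableEq ι] [Fintype ι] in
/-- **`‖T_{√w} f‖² = ‖T_{√w} f₀‖² + w‖T_{√w} f₁‖²`.** [cite: KauersODonnellTanZhou2012, proof of Thm. 3.4 (p. 9: "`E[F_i²] = E[G_i²] + E[H_i²]`")] -/
theorem sqNormW_succ (w : ℝ) (a : Finset (Fin (n + 1)) → MvPolynomial σ ℝ) :
    sqNormW w a = sqNormW w (SosHypercontractivity.lo a) + C w * sqNormW w (hi a) := by
  unfold sqNormW SosHypercontractivity.lo hi
  rw [sum_finset_succ', sum_add_distrib, Finset.mul_sum]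
  congr 1
  · exact sum_congr rfl fun T _ => by rw [card_map]
  · exact sum_congr rfl fun T _ => by
      rw [card_insert_zero_map_succEmb, pow_succ, map_mul]
      ring

omit [DecidableEq ι] [Fintype ι] in
/-- The weighted square norm of a linear family is a sum of squares of linear forms (`w ≥ 0`) — closure of `⊢_k` under nonnegative combinations. [cite: KauersODonnellTanZhou2012, §2 "Simple SOS facts and lemmas", Lemma 2.2 (p. 8)] -/
theorem isSosDeg_sqNormW {w : ℝ} (hw : 0 ≤ w) {a : Finset (Fin n) → MvPolynomial σ ℝ}
    (ha : ∀ S, (a S).totalDegree ≤ 1) : IsSosDeg 1 (sqNormW w a) :=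
  IsSosDeg.sum _ fun S _ => (IsSosDeg.sq (ha S)).const_mul (pow_nonneg hw _)

omit [Fintype ι] in
/-- Products of certificates: degrees add up (iterated `IsSosDeg.mul`). [cite: KauersODonnellTanZhou2012, §2 (p. 6–7)] -/
theorem isSosDeg_prod {k : ℕ} (s : Finset ι) {f : ι → MvPolynomial σ ℝ} (h : ∀ i ∈ s, IsSosDeg k (f i)) :
    IsSosDeg (#s * k) (∏ i ∈ s, f i) := by
  induction s using Finset.induction_on with
  | empty =>
    simp only [card_empty, zero_mul, prod_empty]
    simpa using IsSosDeg.sq (σ := σ) (k := 0) (q := 1) (by simp)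
  | insert i s hi ih =>
    rw [prod_insert hi, card_insert_of_notMem hi, Nat.succ_mul, add_comm]
    exact (h i (mem_insert_self i s)).mul (ih fun j hj => h j (mem_insert_of_mem hj))

/-- The family `(f_i)` with `f_i` replaced by `f_{i,1}` (coefficients involving the first coordinate)
for `i ∈ A` and by `f_{i,0}` otherwise. [cite: KauersODonnellTanZhou2012, proof of Thm. 3.4 (p. 8: "`f_i = x_n g_i + h_i`")] -/
def mix (a : ι → Finset (Fin (n + 1)) → MvPolynomial σ ℝ) (A : Finset ι) (i : ι) :
    Finset (Fin n) → MvPolynomial σ ℝ :=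
  if i ∈ A then hi (a i) else SosHypercontractivity.lo (a i)

omit [Fintype ι] in
/-- Mixed families of linear families are linear. [folklore] -/
private theorem mix_deg {a : ι → Finset (Fin (n + 1)) → MvPolynomial σ ℝ} (ha : ∀ i S, (a i S).totalDegree ≤ 1)
    (A : Finset ι) (i : ι) (S : Finset (Fin n)) : (mix a A i S).totalDegree ≤ 1 := by
  unfold mix; split_ifs
  · exact ha i _
  · exact ha i _

/-- `∏_i φ(if i ∈ A then u_i else v_i) = ∏_{i∈A} φ(u_i) · ∏_{i∉A} φ(v_i)`. [folklore] -/
private theorem prod_univ_ite_mem {β M : Type*} [CommMonoid M] (A : Finset ι) (u v : ι → β) (φ : β → M) :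
    ∏ i, φ (if i ∈ A then u i else v i) = (∏ i ∈ A, φ (u i)) * ∏ i ∈ univ \ A, φ (v i) := by
  have h := prod_piecewise univ A (fun i => φ (u i)) (fun i => φ (v i))
  rw [univ_inter] at h
  rw [← h]
  refine prod_congr rfl fun i _ => ?_
  simp only [Finset.piecewise]
  split_ifs <;> rfl

/-- Products over a mixed family split along `A`. [folklore] -/
private theorem prod_mix {M : Type*} [CommMonoid M] (a : ι → Finset (Fin (n + 1)) → MvPolynomial σ ℝ)
    (A : Finset ι) (φ : (Finset (Fin n) → MvPolynomial σ ℝ) → M) :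
    ∏ i, φ (mix a A i) = (∏ i ∈ A, φ (hi (a i))) * ∏ i ∈ univ \ A, φ (SosHypercontractivity.lo (a i)) :=
  prod_univ_ite_mem A _ _ φ

/-- **KOTZ Theorem 3.4 — the induction, weighted form with an abstract weight.**  For a finite family
`(f_i)_{i∈ι}` of Fourier polynomials with linear coefficients, a weight `w ≥ 0` and the coefficient
condition `2κ_{|ι|}(r) ≤ 2w^r` (`r ≤ |ι|`):
`2ⁿ ∏_i ‖T_{√w} f_i‖₂² − Σ_x ∏_i f_i(x)²` is a sum of squares of polynomials of degree `≤ |ι|`.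
The step `n → n+1` is the printed one: split `f_i = h_i + x₀ g_i`, expand over the sign of `x₀`
(`twoPoint_expand`), apply Lemma 3.3 inside each term (`one_variable`), use the induction hypothesis on
each mixed family `(g_i)_{i∈A} ∪ (h_i)_{i∉A}`, and compare coefficients (`2κ(|A|) ≤ 2w^{|A|}`).
[cite: KauersODonnellTanZhou2012, Thm. 3.4 and its proof (p. 8–9)] -/
theorem weighted_induction (w : ℝ) (hw : 0 ≤ w)
    (hcoef : ∀ r, r ≤ Fintype.card ι → coef (Fintype.card ι) r ≤ 2 * w ^ r) :
    ∀ {n : ℕ} (a : ι → Finset (Fin n) → MvPolynomial σ ℝ), (∀ i S, (a i S).totalDegree ≤ 1) →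
      IsSosDeg (Fintype.card ι)
        (C ((2 : ℝ) ^ n) * ∏ i, sqNormW w (a i) - ∑ x, ∏ i, fourierPoly (a i) x ^ 2) := by
  intro n
  induction n with
  | zero =>
    intro a _
    have h1 : (default : Finset (Fin 0)) = ∅ := Subsingleton.elim _ _
    have hf : ∀ (x : Fin 0 → Bool) i, fourierPoly (a i) x = a i ∅ := by
      intro x i
      unfold fourierPoly
      rw [Fintype.sum_unique, h1, walsh_empty, map_one, one_mul]
    have hs : ∀ i, sqNormW w (a i) = a i ∅ ^ 2 := by
      intro i
      unfold sqNormW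
      rw [Fintype.sum_unique, h1, card_empty, pow_zero, map_one, one_mul]
    have e : C ((2 : ℝ) ^ 0) * ∏ i, sqNormW w (a i) - ∑ x, ∏ i, fourierPoly (a i) x ^ 2 = 0 := by
      rw [Fintype.sum_unique]
      simp_rw [hf, hs]
      simp
    rw [e]
    exact IsSosDeg.zero _
  | succ n ih =>
    intro a ha
    have hG : ∀ (y : Fin n → Bool) i, (fourierPoly (hi (a i)) y).totalDegree ≤ 1 :=
      fun y i => totalDegree_fourierPoly_le (fun S => ha i _) y
    have hH : ∀ (y : Fin n → Bool) i, (fourierPoly (SosHypercontractivity.lo (a i)) y).totalDegree ≤ 1 :=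
      fun y i => totalDegree_fourierPoly_le (fun S => ha i _) y
    -- Step 1: split off the first coordinate (`f_i = h_i + x₀ g_i`)
    have hsplit : ∑ x, ∏ i, fourierPoly (a i) x ^ 2 =
        ∑ y : Fin n → Bool, (∏ i, (fourierPoly (SosHypercontractivity.lo (a i)) y + fourierPoly (hi (a i)) y) ^ 2 +
          ∏ i, (fourierPoly (SosHypercontractivity.lo (a i)) y - fourierPoly (hi (a i)) y) ^ 2) := by
      rw [sum_cube_succ']
      refine sum_congr rfl fun y _ => ?_
      have h0 : ∀ i, fourierPoly (a i) (Fin.cons false y) = fourierPoly (SosHypercontractivity.lo (a i)) y + fourierPoly (hi (a i)) y :=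
        fun i => by rw [fourierPoly_cons, sgn_false, map_one, one_mul]
      have h1 : ∀ i, fourierPoly (a i) (Fin.cons true y) = fourierPoly (SosHypercontractivity.lo (a i)) y - fourierPoly (hi (a i)) y :=
        fun i => by rw [fourierPoly_cons, sgn_true, map_neg, map_one, neg_one_mul, ← sub_eq_add_neg]
      simp_rw [h0, h1]
    -- Step 2–3: the one-variable lemma at each `y`; its main terms are the mixed families
    have hmono : ∀ (y : Fin n → Bool) (A : Finset ι),
        monoProd (fun i => fourierPoly (hi (a i)) y) (fun i => fourierPoly (SosHypercontractivity.lo (a i)) y) A ^ 2 =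
          ∏ i, fourierPoly (mix a A i) y ^ 2 := by
      intro y A
      rw [monoProd, mul_pow, ← prod_pow, ← prod_pow, prod_mix a A (fun b => fourierPoly b y ^ 2)]
    have hy : ∀ y : Fin n → Bool,
        ∏ i, (fourierPoly (SosHypercontractivity.lo (a i)) y + fourierPoly (hi (a i)) y) ^ 2 +
            ∏ i, (fourierPoly (SosHypercontractivity.lo (a i)) y - fourierPoly (hi (a i)) y) ^ 2 =
          ∑ A ∈ (univ : Finset ι).powerset, C (coef (Fintype.card ι) #A) *
              ∏ i, fourierPoly (mix a A i) y ^ 2 -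
            rem (fun i => fourierPoly (hi (a i)) y) (fun i => fourierPoly (SosHypercontractivity.lo (a i)) y) := by
      intro y
      have hov := one_variable (fun i => fourierPoly (hi (a i)) y) (fun i => fourierPoly (SosHypercontractivity.lo (a i)) y)
      rw [eq_sub_iff_add_eq, hov]
      exact sum_congr rfl fun A _ => by rw [hmono]
    have hL : ∑ x, ∏ i, fourierPoly (a i) x ^ 2 =
        ∑ A ∈ (univ : Finset ι).powerset, C (coef (Fintype.card ι) #A) *
            ∑ y : Fin n → Bool, ∏ i, fourierPoly (mix a A i) y ^ 2 -
          ∑ y : Fin n → Bool, rem (fun i => fourierPoly (hi (a i)) y) (fun i => fourierPoly (SosHypercontractivity.lo (a i)) y) := by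
      rw [hsplit, sum_congr rfl fun y _ => hy y, sum_sub_distrib, sum_comm]
      simp_rw [mul_sum]
    -- Step 4: the right-hand side expanded over `A`
    have hR : C ((2 : ℝ) ^ (n + 1)) * ∏ i, sqNormW w (a i) =
        ∑ A ∈ (univ : Finset ι).powerset, C ((2 : ℝ) ^ (n + 1) * w ^ #A) *
          ∏ i, sqNormW w (mix a A i) := by
      have e1 : ∏ i, sqNormW w (a i) = ∏ i, (C w * sqNormW w (hi (a i)) + sqNormW w (SosHypercontractivity.lo (a i))) :=
        prod_congr rfl fun i _ => by rw [sqNormW_succ, add_comm]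
      rw [e1, prod_add, mul_sum]
      refine sum_congr rfl fun A _ => ?_
      rw [prod_C_mul, prod_mix a A (sqNormW w)]
      simp only [map_mul, map_pow, map_ofNat]
      ring
    -- Step 5: the decomposition into certified pieces
    have hdec : C ((2 : ℝ) ^ (n + 1)) * ∏ i, sqNormW w (a i) - ∑ x, ∏ i, fourierPoly (a i) x ^ 2 =
        ∑ A ∈ (univ : Finset ι).powerset,
          (C (coef (Fintype.card ι) #A) *
              (C ((2 : ℝ) ^ n) * ∏ i, sqNormW w (mix a A i) - ∑ y, ∏ i, fourierPoly (mix a A i) y ^ 2) +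
            C ((2 : ℝ) ^ n * (2 * w ^ #A - coef (Fintype.card ι) #A)) * ∏ i, sqNormW w (mix a A i)) +
        ∑ y : Fin n → Bool, rem (fun i => fourierPoly (hi (a i)) y) (fun i => fourierPoly (SosHypercontractivity.lo (a i)) y) := by
      rw [hR, hL, sub_sub_eq_add_sub, add_sub_right_comm, ← sum_sub_distrib, add_left_inj]
      refine sum_congr rfl fun A _ => ?_
      simp only [map_mul, map_sub, map_pow, map_ofNat]
      ring
    rw [hdec]
    -- Step 6: everything is a sum of squares
    refine IsSosDeg.add (IsSosDeg.sum _ fun A _ => IsSosDeg.add ?_ ?_) (IsSosDeg.sum _ fun y _ => ?_)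
    · exact (ih (mix a A) (mix_deg ha A)).const_mul (coef_nonneg _ _)
    · have hcard : #A ≤ Fintype.card ι := card_le_univ A
      refine IsSosDeg.const_mul (mul_nonneg (by positivity) (sub_nonneg.2 (hcoef _ hcard))) ?_
      have := isSosDeg_prod (k := 1) (univ : Finset ι) (f := fun i => sqNormW w (mix a A i))
        fun i _ => isSosDeg_sqNormW hw (mix_deg ha A i)
      simpa using this
    · exact isSosDeg_rem (hG y) (hH y)

end Induction

/-! ### §4a Lemma 3.3 as printed -/

section AMGMPrinted

variable {σ : Type*} {ι : Type*} [DecidableEq ι]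

/-- **Kauers–O'Donnell–Tan–Zhou 2014, Lemma 3.3 (SOS AM–GM over half-subsets).** "Let `v` be an even
positive integer and let `G_1,…,G_v,H_1,…,H_v` be indeterminates. Then
`⊢_{2v} ∏_{i=1}^v G_i H_i ≤ (1/C(v,v/2)) Σ_{T ⊆ [v], |T| = v/2} ∏_{i∈T} G_i² ∏_{i∈[v]∖T} H_i²`."
Here `[v]` is any finite set `V` with `|V| = 2t`, the `G_i, H_i` may be any polynomials of degree `≤ 1`,
and the certificate is explicit: the difference is `(1/(2C(2t,t))) Σ_T (P_T − P_{V∖T})²`,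
`P_T = ∏_{i∈T} G_i ∏_{i∈V∖T} H_i` (squares of polynomials of degree `≤ v`; printed proof: pair `T`
with its complement and use `⊢₂ XY ≤ ½X² + ½Y²`).
[cite: KauersODonnellTanZhou2012, Lemma 3.3 (p. 8)] -/
theorem sos_amgm_halfSubsets (G H : ι → MvPolynomial σ ℝ) (hG : ∀ i, (G i).totalDegree ≤ 1)
    (hH : ∀ i, (H i).totalDegree ≤ 1) {V : Finset ι} {t : ℕ} (hV : #V = 2 * t) :
    IsSosDeg #V (C (1 / ((2 * t).choose t : ℝ)) *
        ∑ T ∈ powersetCard t V, ((∏ i ∈ T, G i ^ 2) * ∏ i ∈ V \ T, H i ^ 2) -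
      ∏ i ∈ V, (G i * H i)) := by
  have hc : ((2 * t).choose t : ℝ) ≠ 0 := by exact_mod_cast (Nat.choose_pos (by omega)).ne'
  have key := amgm_identity G H hV
  -- solve the identity for `∏ G H`
  have hprod : ∏ i ∈ V, (G i * H i) = C (1 / (2 * ((2 * t).choose t : ℝ))) *
      (2 * ∑ T ∈ powersetCard t V, halfProd G H V T ^ 2 -
        ∑ T ∈ powersetCard t V, (halfProd G H V T - halfProd G H V (V \ T)) ^ 2) := by
    rw [← key, ← mul_assoc, show (2 * ((2 * t).choose t : MvPolynomial σ ℝ)) =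
      C (2 * ((2 * t).choose t : ℝ)) by rw [map_mul, map_natCast, map_ofNat], ← map_mul,
      one_div, inv_mul_cancel₀ (by positivity), map_one, one_mul]
  have hsq : ∀ T ∈ powersetCard t V, (∏ i ∈ T, G i ^ 2) * ∏ i ∈ V \ T, H i ^ 2 = halfProd G H V T ^ 2 := by
    intro T _; rw [halfProd, mul_pow, ← prod_pow, ← prod_pow]
  have e : C (1 / ((2 * t).choose t : ℝ)) * ∑ T ∈ powersetCard t V, ((∏ i ∈ T, G i ^ 2) * ∏ i ∈ V \ T, H i ^ 2) -
      ∏ i ∈ V, (G i * H i) =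
      C (1 / (2 * ((2 * t).choose t : ℝ))) *
        ∑ T ∈ powersetCard t V, (halfProd G H V T - halfProd G H V (V \ T)) ^ 2 := by
    rw [sum_congr rfl hsq, hprod, show (1 / ((2 * t).choose t : ℝ)) = 2 * (1 / (2 * ((2 * t).choose t : ℝ))) by
      field_simp, map_mul, map_ofNat]
    ring
  rw [e]
  refine (IsSosDeg.sum _ fun T hT => IsSosDeg.sq ?_).const_mul (by positivity)
  exact (totalDegree_sub _ _).trans (max_le (totalDegree_halfProd_le hG hH (mem_powersetCard.1 hT).1)
    (totalDegree_halfProd_le hG hH sdiff_subset))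

end AMGMPrinted

/-! ### §4 The printed statements (KOTZ Theorem 3.4 and its corollaries, p. 3 and p. 8) -/

section Printed

variable {σ : Type*} {n : ℕ}

/-- `coef s r = 2κ_s(r)`: the two bookkeepings of the same coefficient agree. [cite: KauersODonnellTanZhou2012, proof of Thm. 3.4, eq. (5)–(6) (p. 10)] -/
theorem coef_eq_two_mul_kap (s r : ℕ) : coef s r = 2 * kap s r := by
  rw [coef, kap, mul_sum]
  rw [sum_range_eq_of_vanish (s - r) r _ (fun t ht => ?_) (fun t ht => ?_)]
  · refine sum_congr rfl fun t _ => ?_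
    push_cast
    ring
  · rw [Nat.choose_eq_zero_of_lt ht]; simp
  · rw [Nat.choose_eq_zero_of_lt (k := t) (n := r) ht]; simp

/-- **`2κ_s(r) ≤ 2(2s−1)^r`** (`r ≤ s`). [cite: KauersODonnellTanZhou2012, proof of Thm. 3.4 (p. 10) with Remark 3.1 (p. 8)] -/
theorem coef_le (s r : ℕ) (hr : r ≤ s) : coef s r ≤ 2 * (2 * s - 1 : ℝ) ^ r := by
  rw [coef_eq_two_mul_kap]
  have := kap_le s r hr
  linarith

/-- **Kauers–O'Donnell–Tan–Zhou 2014, Theorem 3.4 (Rademacher case), weighted form / cleared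
denominators.**  For `s ≥ 1` and coefficient families `a_1,…,a_s` (`a_i S = f̂_i(S)`, polynomials of
degree `≤ 1`):
`2ⁿ · ∏_{i=1}^s (Σ_S (2s−1)^{|S|} f̂_i(S)²) − Σ_{x∈{0,1}ⁿ} ∏_{i=1}^s f_i(x)²`
is a sum of squares of polynomials of degree `≤ s` in the coefficients — i.e.
`⊢_{2s} E[∏_i f_i²] ≤ ∏_i ‖T_{√(2s−1)} f_i‖₂²`, the form `two_function_sos_hypercontractivity_noise`
has for `s = 2`.  (Printed for independent real random variables under the "`s`-Moment Conditions";
this is the case of uniform `±1` bits, which satisfy them by Remark 3.1.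
-- TODO(general form): arbitrary product distributions with the `s`-Moment Conditions (p. 8).)
[cite: KauersODonnellTanZhou2012, Thm. 3.4 (p. 8–9)] -/
theorem multi_function_sos_hypercontractivity_weighted (s : ℕ) {n : ℕ}
    (a : Fin s → Finset (Fin n) → MvPolynomial σ ℝ) (ha : ∀ i S, (a i S).totalDegree ≤ 1) :
    IsSosDeg s (C ((2 : ℝ) ^ n) * ∏ i, sqNormW (2 * s - 1 : ℝ) (a i) -
      ∑ x, ∏ i, fourierPoly (a i) x ^ 2) := by
  rcases Nat.eq_zero_or_pos s with hs | hs
  · subst hs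
    have e : C ((2 : ℝ) ^ n) * ∏ i : Fin 0, sqNormW (2 * ((0 : ℕ) : ℝ) - 1) (a i) -
        ∑ x : Fin n → Bool, ∏ i : Fin 0, fourierPoly (a i) x ^ 2 = 0 := by
      rw [Fintype.prod_empty, mul_one, sub_eq_zero]
      simp_rw [Fintype.prod_empty]
      rw [sum_const, card_univ, Fintype.card_fun, Fintype.card_bool, Fintype.card_fin, nsmul_eq_mul,
        mul_one, map_pow, map_ofNat, Nat.cast_pow, Nat.cast_ofNat]
    rw [e]; exact IsSosDeg.zero 0
  have hw : (0 : ℝ) ≤ 2 * s - 1 := by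
    have : (1 : ℝ) ≤ s := by exact_mod_cast hs
    linarith
  have hc : ∀ r, r ≤ Fintype.card (Fin s) → coef (Fintype.card (Fin s)) r ≤ 2 * (2 * s - 1 : ℝ) ^ r := by
    intro r hr
    rw [Fintype.card_fin] at hr ⊢
    exact coef_le s r hr
  have h := weighted_induction (ι := Fin s) (σ := σ) (2 * s - 1 : ℝ) hw hc a ha
  rw [Fintype.card_fin] at h
  exact h

omit n in
/-- Multiplying by a constant does not raise the degree. [folklore] -/
private theorem totalDegree_C_mul_le' (c : ℝ) (p : MvPolynomial σ ℝ) :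
    (C c * p).totalDegree ≤ p.totalDegree :=
  (totalDegree_mul _ _).trans (by rw [totalDegree_C, zero_add])

/-- Comparing two products of weighted square norms termwise: if `0 ≤ c' ≤ c` entrywise then
`∏_i (Σ_S c_{iS} a_{iS}²) − ∏_i (Σ_S c'_{iS} a_{iS}²) = Σ_p (∏_i c_{i,p_i} − ∏_i c'_{i,p_i})·(∏_i a_{i,p_i})²`
is a sum of squares of polynomials of degree `≤ |ι|` (closure of `⊢_k` under nonnegative combinations,
applied to the comparison `‖T_ρ' f‖ ≤ ‖T_ρ f‖`, `ρ' ≤ ρ`). [cite: KauersODonnellTanZhou2012, §2 "Simple SOS facts and lemmas", Lemma 2.2 (p. 8)] -/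
theorem isSosDeg_prod_weighted_sub {ι κ : Type*} [DecidableEq ι] [Fintype ι] [DecidableEq κ]
    (t : Finset κ) {b : ι → κ → MvPolynomial σ ℝ} {c c' : ι → κ → ℝ}
    (hb : ∀ i S, (b i S).totalDegree ≤ 1) (hle : ∀ i S, c' i S ≤ c i S) (h0 : ∀ i S, 0 ≤ c' i S) :
    IsSosDeg (Fintype.card ι) (∏ i, ∑ S ∈ t, C (c i S) * b i S ^ 2 -
      ∏ i, ∑ S ∈ t, C (c' i S) * b i S ^ 2) := by
  rw [prod_univ_sum, prod_univ_sum, ← sum_sub_distrib]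
  refine IsSosDeg.sum _ fun p _ => ?_
  have e : ∏ i, C (c i (p i)) * b i (p i) ^ 2 - ∏ i, C (c' i (p i)) * b i (p i) ^ 2 =
      C (∏ i, c i (p i) - ∏ i, c' i (p i)) * (∏ i, b i (p i)) ^ 2 := by
    rw [prod_mul_distrib, prod_mul_distrib, prod_pow, ← map_prod, ← map_prod, map_sub]
    ring
  rw [e]
  refine (IsSosDeg.sq ?_).const_mul (sub_nonneg.2 (prod_le_prod (fun i _ => h0 i _) fun i _ => hle i _))
  exact (totalDegree_finsetProd _ _).trans ((sum_le_sum fun i _ => hb i (p i)).trans (by simp))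

/-- **Kauers–O'Donnell–Tan–Zhou 2014, Theorem 3.4 (Rademacher case, as printed, eq. (3)).**
"Fix `s ∈ ℕ⁺` and write `q = 2s`. Let `0 ≤ ρ ≤ 1/√(q−1)`. … for each `1 ≤ i ≤ s` and each `S ⊆ [n]`,
introduce an indeterminate `f̂_i(S)` … `f_i(x) = Σ_S f̂_i(S) ∏_{j∈S} x_j`,
`T_ρ f_i(x) = Σ_S ρ^{|S|} f̂_i(S) ∏_{j∈S} x_j`. Let `x = (x_1,…,x_n)` be a sequence of independent real
random variables satisfying the `s`-Moment Conditions. Then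
`⊢_q E[∏_{i=1}^s (T_ρ f_i(x))²] ≤ ∏_{i=1}^s E[f_i(x)²]`."  Here for uniform `±1` bits (Walsh
characters `χ_S` on `{0,1}ⁿ`): `∏_i (Σ_S f̂_i(S)²) − E_x ∏_i (T_ρ f_i)(x)²` is a sum of squares of
polynomials of degree `≤ s` in the coefficients; the coefficients may be any polynomials of degree
`≤ 1` (indeterminates, linear forms, `0`).  (`‖·‖` conditions as in the weighted form;
-- TODO(general form): the `s`-Moment Conditions version, p. 8.)
[cite: KauersODonnellTanZhou2012, Thm. 3.4 (p. 8), Thm. 1.1/"Theorem 1.4 (informal)" (p. 3)] -/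
theorem multi_function_sos_hypercontractivity {s : ℕ} (hs : 1 ≤ s) {ρ : ℝ} (hρ : 0 ≤ ρ)
    (hρ' : ρ ≤ 1 / Real.sqrt (2 * s - 1)) {n : ℕ}
    (a : Fin s → Finset (Fin n) → MvPolynomial σ ℝ) (ha : ∀ i S, (a i S).totalDegree ≤ 1) :
    IsSosDeg s (∏ i, sqNorm (a i) - C ((2 : ℝ) ^ n)⁻¹ * ∑ x, ∏ i, fourierPoly (noise ρ (a i)) x ^ 2) := by
  have hw1 : (1 : ℝ) ≤ 2 * s - 1 := by
    have : (1 : ℝ) ≤ s := by exact_mod_cast hs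
    linarith
  have hρw : ρ ^ 2 * (2 * s - 1) ≤ 1 := by
    have hρ2 : ρ * Real.sqrt (2 * s - 1) ≤ 1 := by
      have hpos : 0 < Real.sqrt (2 * s - 1) := Real.sqrt_pos.2 (by linarith)
      have := mul_le_mul_of_nonneg_right hρ' hpos.le
      rwa [one_div, inv_mul_cancel₀ hpos.ne'] at this
    have hsq : Real.sqrt (2 * s - 1) ^ 2 = 2 * s - 1 := Real.sq_sqrt (by linarith)
    nlinarith [mul_nonneg hρ (Real.sqrt_nonneg (2 * s - 1))]
  -- the weighted statement for the noised families
  have hna : ∀ i S, (noise ρ (a i) S).totalDegree ≤ 1 := fun i S => (totalDegree_C_mul_le' _ _).trans (ha i S)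
  have h1 := multi_function_sos_hypercontractivity_weighted s (fun i => noise ρ (a i)) hna
  -- comparing `∏ ‖f_i‖²` with `∏ ‖T_{√w} T_ρ f_i‖²`
  have ew : ∀ i, sqNormW (2 * s - 1 : ℝ) (noise ρ (a i)) =
      ∑ S, C ((ρ ^ 2 * (2 * s - 1)) ^ S.card) * a i S ^ 2 := by
    intro i
    unfold sqNormW noise
    refine sum_congr rfl fun S _ => ?_
    rw [mul_pow, ← map_pow, ← mul_assoc, ← map_mul,
      show (2 * s - 1 : ℝ) ^ S.card * (ρ ^ S.card) ^ 2 = (ρ ^ 2 * (2 * s - 1)) ^ S.card by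
        rw [mul_pow, ← pow_mul, ← pow_mul]; ring]
  have e1 : ∀ i, sqNorm (a i) = ∑ S, C ((fun (_ : Fin s) (_ : Finset (Fin n)) => (1 : ℝ)) i S) * a i S ^ 2 := by
    intro i; unfold sqNorm; simp
  have hcmp : IsSosDeg s (∏ i, sqNorm (a i) - ∏ i, sqNormW (2 * s - 1 : ℝ) (noise ρ (a i))) := by
    have := isSosDeg_prod_weighted_sub (ι := Fin s) (σ := σ) univ (b := a)
      (c := fun _ _ => (1 : ℝ)) (c' := fun _ S => (ρ ^ 2 * (2 * s - 1)) ^ S.card) ha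
      (fun _ S => pow_le_one₀ (by positivity) hρw) (fun _ S => by positivity)
    simp only [Fintype.card_fin] at this
    convert this using 2
    · exact prod_congr rfl fun i _ => e1 i
    · exact prod_congr rfl fun i _ => ew i
  have h2 := (h1.const_mul (c := ((2 : ℝ) ^ n)⁻¹) (by positivity)).add hcmp
  convert h2 using 1
  rw [mul_sub, ← mul_assoc, ← map_mul, inv_mul_cancel₀ (by positivity), map_one, one_mul]
  ring

/-- **KOTZ, the single-function corollary "`⊢_q ‖T_ρ f‖_q^q ≤ ‖f‖₂^q`"** (`q = 2s`,
`0 ≤ ρ ≤ 1/√(q−1)`; all `f_i = f` in Theorem 3.4): `(Σ_S f̂(S)²)^s − E_x (T_ρ f)(x)^{2s}` is a sum of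
squares of polynomials of degree `≤ s`. [cite: KauersODonnellTanZhou2012, Thm. 1.1 corollaries ("As corollaries we have SOS proofs of …", p. 3)] -/
theorem sos_hypercontractivity_even_noise_self {s : ℕ} (hs : 1 ≤ s) {ρ : ℝ} (hρ : 0 ≤ ρ)
    (hρ' : ρ ≤ 1 / Real.sqrt (2 * s - 1))
    (a : Finset (Fin n) → MvPolynomial σ ℝ) (ha : ∀ S, (a S).totalDegree ≤ 1) :
    IsSosDeg s (sqNorm a ^ s - C ((2 : ℝ) ^ n)⁻¹ * ∑ x, fourierPoly (noise ρ a) x ^ (2 * s)) := by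
  have h := multi_function_sos_hypercontractivity hs hρ hρ' (fun _ : Fin s => a) fun _ S => ha S
  simp only [prod_const, card_univ, Fintype.card_fin] at h
  convert h using 4
  rw [pow_mul]

/-- The weighted norm of a projected family: `Σ_S w^{|S|} (P_d f)^(S)² = Σ_S [|S| ≤ d] w^{|S|} f̂(S)²`. [folklore] -/
private theorem sqNormW_proj (w : ℝ) (d : ℕ) (a : Finset (Fin n) → MvPolynomial σ ℝ) :
    sqNormW w (proj d a) = ∑ S, C (if S.card ≤ d then w ^ S.card else 0) * a S ^ 2 := by
  unfold sqNormW proj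
  refine sum_congr rfl fun S _ => ?_
  split_ifs <;> simp

/-- **KOTZ, the projector corollary "`⊢_q ‖P^{≤k} f‖_q^q ≤ (q−1)^{qk/2} ‖f‖₂^q`"** (`q = 2s`, so
`(q−1)^{qk/2} = (2s−1)^{ks}`), with all `2ⁿ` Fourier coefficients `f̂(S) = X_S` as indeterminates:
`(2s−1)^{ks} (Σ_S X_S²)^s − E_x (P_k f)(x)^{2s}` is a sum of squares of polynomials of degree `≤ s`.
For `s = 2` this is BBHKSZ Theorem 2.2 (`sos_hypercontractivity_projector`, constant `9^k`).
[cite: KauersODonnellTanZhou2012, Thm. 1.1 corollaries (p. 3); Thm. 3.4 (p. 8)] -/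
theorem sos_hypercontractivity_even_projector (n k s : ℕ) (hs : 1 ≤ s) :
    IsSosDeg s (C ((2 * s - 1 : ℝ) ^ (k * s)) * (∑ S : Finset (Fin n), X S ^ 2) ^ s -
      C ((2 : ℝ) ^ n)⁻¹ * ∑ x, fourierPoly (proj k fun S => X S) x ^ (2 * s) :
      MvPolynomial (Finset (Fin n)) ℝ) := by
  classical
  have hw1 : (1 : ℝ) ≤ 2 * s - 1 := by
    have : (1 : ℝ) ≤ s := by exact_mod_cast hs
    linarith
  have hX : ∀ S : Finset (Fin n), (X S : MvPolynomial (Finset (Fin n)) ℝ).totalDegree ≤ 1 :=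
    fun S => (totalDegree_X _).le
  have ha : ∀ S, (proj k (fun S => (X S : MvPolynomial (Finset (Fin n)) ℝ)) S).totalDegree ≤ 1 := by
    intro S; unfold proj; split_ifs
    · exact hX S
    · simp
  have h1 := multi_function_sos_hypercontractivity_weighted s (fun _ : Fin s => proj k fun S => X S)
    fun _ S => ha S
  simp only [prod_const, card_univ, Fintype.card_fin] at h1
  -- `(2s−1)^{ks} (Σ_S X_S²)^s − ‖T_{√(2s−1)} P_k f‖^{2s}` is a sum of squares
  have hcmp : IsSosDeg s (C ((2 * s - 1 : ℝ) ^ (k * s)) *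
        (∑ S : Finset (Fin n), (X S : MvPolynomial (Finset (Fin n)) ℝ) ^ 2) ^ s -
      sqNormW (2 * s - 1 : ℝ) (proj k fun S => (X S : MvPolynomial (Finset (Fin n)) ℝ)) ^ s) := by
    have := isSosDeg_prod_weighted_sub (ι := Fin s) (σ := Finset (Fin n)) univ
      (b := fun _ S => (X S : MvPolynomial (Finset (Fin n)) ℝ))
      (c := fun _ _ => (2 * s - 1 : ℝ) ^ k) (c' := fun _ S => if S.card ≤ k then (2 * s - 1 : ℝ) ^ S.card else 0)
      (fun _ S => hX S)
      (fun _ S => by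
        show (if S.card ≤ k then (2 * s - 1 : ℝ) ^ S.card else 0) ≤ (2 * s - 1 : ℝ) ^ k
        split_ifs with h
        · exact pow_le_pow_right₀ hw1 h
        · positivity)
      (fun _ S => by
        show (0 : ℝ) ≤ if S.card ≤ k then (2 * s - 1 : ℝ) ^ S.card else 0
        split_ifs <;> positivity)
    rw [prod_const, prod_const, card_univ, Fintype.card_fin] at this
    have epow : C ((2 * s - 1 : ℝ) ^ (k * s)) *
        (∑ S : Finset (Fin n), (X S : MvPolynomial (Finset (Fin n)) ℝ) ^ 2) ^ s =
        (∑ S : Finset (Fin n), C ((2 * s - 1 : ℝ) ^ k) * (X S : MvPolynomial (Finset (Fin n)) ℝ) ^ 2) ^ s := by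
      rw [← mul_sum, mul_pow, ← map_pow, ← pow_mul]
    rw [epow, sqNormW_proj]
    exact this
  have h2 := (h1.const_mul (c := ((2 : ℝ) ^ n)⁻¹) (by positivity)).add hcmp
  convert h2 using 1
  rw [mul_sub, ← mul_assoc, ← map_mul, inv_mul_cancel₀ (by positivity), map_one, one_mul]
  have e3 : ∀ x : Fin n → Bool,
      (fourierPoly (proj k fun S => (X S : MvPolynomial (Finset (Fin n)) ℝ)) x ^ 2) ^ s =
        fourierPoly (proj k fun S => (X S : MvPolynomial (Finset (Fin n)) ℝ)) x ^ (2 * s) := by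
    intro x; rw [← pow_mul]
  simp_rw [e3]
  ring

/-- **The consumer form (what a degree-`2s` pseudo-expectation sees).** Every linear functional `Ẽ`
on the coefficient polynomials that is nonnegative on squares of polynomials of degree `≤ s`
satisfies `Ẽ[E_x (P_k f)(x)^{2s}] ≤ (2s−1)^{ks} · Ẽ[(Σ_S f̂(S)²)^s]`.
[cite: KauersODonnellTanZhou2012, §1.1 (p. 3: "hypercontractive inequalities have played a key role in many of the sophisticated SDP integrality gap instances") and Thm. 3.4 (p. 8)] -/
theorem pseudoexpectation_evenMoment_le (n k s : ℕ) (hs : 1 ≤ s)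
    (E : MvPolynomial (Finset (Fin n)) ℝ →ₗ[ℝ] ℝ)
    (hE : ∀ q : MvPolynomial (Finset (Fin n)) ℝ, q.totalDegree ≤ s → 0 ≤ E (q ^ 2)) :
    E (C ((2 : ℝ) ^ n)⁻¹ * ∑ x, fourierPoly (proj k fun S => X S) x ^ (2 * s)) ≤
      (2 * s - 1 : ℝ) ^ (k * s) * E ((∑ S : Finset (Fin n), X S ^ 2) ^ s) := by
  have h := (sos_hypercontractivity_even_projector n k s hs).pseudoexpectation_nonneg E hE
  rw [map_sub, ← smul_eq_C_mul, map_smul, smul_eq_mul] at h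
  linarith

/-- **The numerical `(2,2s)`-hypercontractive (Bonami) inequality, read off the certificate**: for real
coefficients `c_S` supported on `|S| ≤ k`, `2⁻ⁿ Σ_x (Σ_S c_S χ_S(x))^{2s} ≤ (2s−1)^{ks} (Σ_S c_S²)^s`
(KOTZ Theorem 1.2 for Rademacher bits, `‖F‖_{2s} ≤ (2s−1)^{d/2} ‖F‖₂`, raised to the power `2s`; the
tree's `LowDegree.bonami_even_moment` is the same inequality proved directly).
[cite: KauersODonnellTanZhou2012, Thm. 1.2 (p. 2) and Thm. 3.4 (p. 8)] -/
theorem evenMoment_hypercontractivity_of_certificate (k s : ℕ) (hs : 1 ≤ s) (c : Finset (Fin n) → ℝ)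
    (hc : ∀ S, k < S.card → c S = 0) :
    ((2 : ℝ) ^ n)⁻¹ * ∑ x : Fin n → Bool, (∑ S, c S * walsh S x) ^ (2 * s) ≤
      (2 * s - 1 : ℝ) ^ (k * s) * (∑ S, c S ^ 2) ^ s := by
  classical
  have h := (sos_hypercontractivity_even_projector n k s hs).eval_nonneg c
  have e2 : ∀ x : Fin n → Bool, MvPolynomial.eval c
      (fourierPoly (proj k fun S => (X S : MvPolynomial (Finset (Fin n)) ℝ)) x) = ∑ S, c S * walsh S x := by
    intro x
    rw [eval_fourierPoly_proj_X]
    refine sum_congr rfl fun S _ => ?_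
    by_cases hS : S.card ≤ k
    · rw [if_pos hS]
    · rw [if_neg hS, hc S (not_le.1 hS)]
  rw [map_sub, map_mul, eval_C, map_pow, map_sum, map_mul, eval_C, map_sum] at h
  simp_rw [map_pow, eval_X, e2] at h
  linarith

end Printed

end Literature.Computability.Complexity.SosHypercontractivityEvenMoments

end
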